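import Literature.MathematicalPhysics.QuantumFieldTheory.Balaban1983to89.B1Cor23RegularRegion
import Literature.MathematicalPhysics.QuantumFieldTheory.Balaban1983to89.B1Cor23DerivZeroFieldRegion

/-!
# `Balaban1983to89.B1Cor23DerivRegularRegion` — T. Bałaban, *Regularity and decay of lattice Green's functions*, Commun. Math. Phys.
# **89** (1983) 571–597 [Balaban1983RegularityDecay], **COROLLARY 2.3 (2.30), THE THREE DERIVATIVE PAIRINGS
# `⟨h, D^η_AG_k(Ω,A)g′⟩`, `⟨g, G_k(Ω,A)D^{η*}_Ah⟩`, `⟨h, D^η_AG_k(Ω,A)D^{η*}_Ah′⟩`, AT A REGULAR VECTOR FIELD `A ≠ 0` FOR REGIONS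
# `Ω ⊂ T_ε`** (any union of
# `k`-fold blocks) for the CONCRETE (Higgs)₂,₃ propagator `G^ε_k(Ω, A) = HiggsCovariance.propagatorK C Ω A m² a k` of [Balaban1982Higgs1]
# (2.20) p. 610 and the COVARIANT difference derivative `D^ε_A` of [Balaban1982Higgs1] (1.7) p. 605 with its (1.5)-adjoint `D^{ε*}_A`:
# `|⟨h, D^ε_AG^ε_k(Ω,A)g′⟩|, |⟨g, G^ε_k(Ω,A)D^{ε*}_Ah⟩| ≤ c₁(L^kε)e^{−δr/L^k}‖·‖‖·‖`, `|⟨h, D^ε_AG^ε_k(Ω,A)D^{ε*}_Ah′⟩| ≤ c₂e^{−δr/L^k}‖h‖‖h′‖`,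
# ONE `(δ, c₁, c₂)` for every `ε`, torus, `Ω`, `k`, `m²` and every `A` regular on `Ω` below the (1.8) threshold — the companion of r14
# g14's `B1Cor23RegularRegion` (first pairing at a regular `A`) and the regular-field version of r14 g9's `B1Cor23DerivZeroFieldRegion`

statement-level skeleton of published theorems with citation tags; proofs where landed; nothing here is a claim about the Yang–Mills mass gap

PDF held: `paper:balaban1983-cmp89-regularity-decay` (journal page = PDF page + 570), p. 580 [PDF 10] (2.30), p. 572 [PDF 2] ((1.3), (1.4)
`D^η_{A,μ}`), p. 573 [PDF 3] (1.8); [Balaban1982Higgs1] = `paper:balaban1982-cmp85-higgs23-i`, p. 605 [PDF 3] (1.7) `D^ε_A`, `U(A)* = U(−A)`,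
p. 610 [PDF 8] (2.20), (2.23) (OCR `p0003.txt`, `p0008.txt` re-read by this seat).

CITATION HEADER (lean-in-tree rule).  Cell `lit-balaban` (HOME `run/shared/lean/pub/lit-balaban/`), reader/typer seat **r14** gen 14
(unit `lit-balaban-r14`, B1 fold owner; TAKING line HOME/STATUS.md 2026-08-22T07:18:39Z).  SKELETON rows **B1.Prop2.3** / **B1.Prop2.1**
(the `L²`-version [13] Cor. 2.3 of Prop. 2.1, INPUT of (2.34)/(2.38)) and **B1.Eq2.20**; [B4] row B4.Cor2.3 is r01ʼs (this file is a MODEL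
INSTANCE at a regular `A` on the concrete carrier, not the rowʼs decl of record).  SIBLINGS, BY NAME, never restated: r14 g14
`B1Cor23RegularRegion.{covDeriv_eq, covOpK_conj_ge, sNorm_conj_propagatorK_le, propagatorK_indicator_comm, delta_admissible …}` (first pairing
at a regular `A`; this file follows its §4 and g9ʼs §1–§5 architecture), `B1Ineq18RegularRegion.{coercive_covOpK_regular_region_uniform,
gammaReg_pos}` ((1.8) at a regular `A` for regions — the coercivity USED in §5); r14 g9 `B1Cor23ZeroFieldRegion.{exists_weight,
tdist_le_of_blockIter_eq_real}`, `B1Cor23DerivZeroFieldRegion.bondInner_comm`, `B1Prop23ZeroFieldRegion.siteInner_indicator_self_le`; typer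
`HiggsCovariancePos.{siteInner_covLaplacianN, covOpK_propagatorK_apply, siteInner_projPk_nonneg, inner_star_U, unshift_shift, shiftEquiv}`,
`B1Eq230FluctCovPos.siteInner_propagatorK_comm`, `HiggsCovarianceCont.{sNorm, abs_siteInner_le}`, `B1Ineq233Upper.sum_bond_src_sq`,
`B1Ineq234LevelZero.{tdist_shift_le_one, tdist_comm}`, `B2Ineq329ZeroAveraging.mesh_eq`, `HiggsLattice.ChargeData.star_U`.

WHAT IS PRINTED (verbatim, [13] p. 580 [PDF 10]): *"Corollary 2.3. If Ω and A are as in Proposition I.2.1, then there exist positive constants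
c₀, δ₀ such that for arbitrary scalar field configurations f, f′ defined on Ω, we have |⟨f, G_k(Ω,A)f′⟩|, |⟨f, D^η_{A,μ}G_k(Ω,A)f′⟩|,
|⟨f, G_k(Ω,A)D^{η*}_{A,ν}f′⟩|, |⟨f, D^η_{A,μ}G_k(Ω,A)D^{η*}_{A,ν}f′⟩| ≤ c₀e^{−δ₀dist(supp f, supp f′)}‖f‖₂‖f′‖₂. (2.30)"*; [Balaban1982Higgs1]
p. 605: *"(D^ε_Aφ)_{⟨x,x′⟩} = ε^{−1}(U(A_{⟨x,x′⟩})φ(x′) − φ(x)) (1.7) … Antisymmetry of q implies U(A)* = U(−A)"*; p. 610 (2.23): «A regular on Ω».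

DICTIONARY.  `T_ε = HiggsLattice.Site P 0`, (1.3) `|x − x′| = Site.tdist`; `Ω ⊂ T_ε` a union of `k`-fold blocks (`hΩ`); a bond field
*"defined on Ω"* ↦ `h : PBond P 0 → ℝ^N` VANISHING OFF THE BONDS INSIDE `Ω`; `D^η_{A}G ↦ covDeriv C A (G ·)` ((1.7), all directions at
once); `D^{η*}_Ah ↦` the explicit (1.5)-adjoint `(D^{ε*}_Ah)(x) = ε^{−1}Σ_ν(U(A_{⟨x−εe_ν,x⟩})*h(⟨x − εe_ν, x⟩) − h(⟨x, x + εe_ν⟩))`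
(certified by `siteInner_adjCovDeriv`); `dist(supp f, supp f′) ↦` any `r ≤ |b₋ − x′|` on the supports, exponent `δ·r/L^k`; the factor
`L^kε` is the rescaling [B1] (2.22) of `η^{−1}D` against `(L^kε)²G`; «A as in Proposition I.2.1» ↦ one-step differences of `A` bounded by
`δ_A` at the sites of `Ω` with `d²·ε|e|·L^{2k}·δ_A ≤ 1/3` (the (1.8) threshold of `B1Ineq18RegularRegion`), or the (2.23) currency.

WHAT THIS FILE PROVES (kernel-checked, zero `sorry`, theorems only; axioms standard).
* §1 **`covDeriv_expNegSmul`** (weighted covariant Leibniz rule `D_A(e^{−ρ}w)(b) = e^{−ρ(b₊)}D_Aw(b) + ε^{−1}(e^{−ρ(b₊)} − e^{−ρ(b₋)})w(b₋)`,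
  `U(A_b)` is linear), **`norm_covDeriv_expNegSmul_le`**.
* §2 **`dirichlet_conj_propagatorK_le`**: `⟨w, −Δ_{A,Ω}w⟩ ≤ (4/γ)(L^kε)²‖g′‖²` for `w = e^{ρ}G^ε_k(Ω,A)g′` (coercivity `γ`, admissible `δ`).
* §3 `dirichlet_eq_sum_sq`, **`abs_bondInner_covDeriv_le`**, **`pairing_DG_of_coercive`**
  (`|⟨h, D^ε_AG^ε_k(Ω,A)g′⟩| ≤ (2/√γ + 4√d·δ/γ)(L^kε)e^{δ}e^{−δr/L^k}‖h‖‖g′‖`, `g′ ⊂ Ω`).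
* §4 `covDeriv_propagatorK_eq_indicator`, **`pairing_DG_of_coercive_any`** (arbitrary `g′`), **`siteInner_adjCovDeriv`** (`⟨φ, D^{ε*}_Ah⟩ =
  ⟨D^ε_Aφ, h⟩_{bonds}` for the explicit adjoint — unitarity `U* = U(−A)`), **`pairing_GDt_of_coercive`** (THIRD pairing = second with roles
  exchanged, by the symmetry of `G^ε_k(Ω,A)` and the adjointness).
* §5 with the (1.8)-coercivity `γ₀ = min{2, a(1 − L^{−2})/4}` at a regular `A` (`1 ≤ k ≤ K`, `m² > 0`, `a > 0`, `L > 1`, `(4d + 4a)δ ≤ γ₀`):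
  **`pairing_DG_regular_region`**, **`pairing_GDt_regular_region`**.
* §6 (private) `shift_unshift'`; `exists_bond_of_adjCovDeriv_ne_zero`, `adjCovDeriv_supported` (`supp D^{ε*}_Ah′ ⊂` endpoints of `supp h′ ⊂ Ω`),
  **`energy_conj_propagatorK_adjCovDeriv_le`** (divergence-form source at a general `A`: `⟨w,−Δ_{A,Ω}w⟩ ≤ 16‖h′‖²`, `‖w‖² ≤ (8/γ)(L^kε)²‖h′‖²`
  for `w = e^{ρ}G^ε_k(Ω,A)D^{ε*}_Ah′` — the gain `⟨w, D^{ε*}_Ah′⟩ = ⟨D^ε_Aw, h′⟩ ≤ ⟨w,−Δ_{A,Ω}w⟩^{1/2}‖h′‖`), **`pairing_DGDt_of_coercive`**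
  (`|⟨h, D^ε_AG^ε_k(Ω,A)D^{ε*}_Ah′⟩| ≤ (4 + 2δ(8d/γ)^{1/2})e^{δ}e^{−δr/L^k}‖h‖‖h′‖`), **`pairing_DGDt_regular_region`**.
* §7 **`cor23_deriv_regular_region`**: THE PRINTED QUANTIFIER SHAPE — `∃ δ₀ c₀ > 0` depending on `d, L, a` only such that, for every torus,
  `C`, `N`, `m² > 0`, `1 ≤ k ≤ K` with `L^kε ≤ 1`, every block union `Ω`, EVERY `A` regular on `Ω` below the threshold and every `r`, the
  SECOND, THIRD and FOURTH pairings are `≤ c₀e^{−δ₀r/L^k}‖·‖‖·‖` (first pairing: `B1Cor23RegularRegion.cor23_first_regular_region`).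
HONEST SCOPE / DIVERGENCE.  (i) `Ω` = any union of `k`-fold blocks — weaker than *"unions of big blocks"*; sources `g′ ⊂ Ω` in §3 as
printed, arbitrary in §4; bond fields vanish off the bonds inside `Ω` (the Neumann form only contains those bonds); (ii) METHOD: one-step
Combes–Thomas conjugation plus a weighted covariant Leibniz rule, NOT the printʼs random-walk expansion — a disclosed divergence serving the
printed STATEMENT; constants explicit and crude (`e^{δ} ≤ e`); `m² > 0` needed only for the invertibility of (2.20); (iii) regularity
hypothesis = the (1.8) threshold form of `B1Ineq18RegularRegion` (bounded one-step differences of `A` on `Ω`), which the printed (2.23)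
implies for `e(L^kε)` small (`B1Ineq18RegularRegion.coercive_covOpK_of_reg223`); (iv) the `∃ δ₀ c₀` repackaging §7 needs `L^kε ≤ 1` (to
drop the factor `L^kε` of the second/third pairing); (v) nothing here is summit progress.
-/

noncomputable section

open scoped BigOperators InnerProductSpace

namespace Literature.MathematicalPhysics.QuantumFieldTheory.Balaban1983to89.B1Cor23DerivRegularRegion

open HiggsLattice HiggsAveraging HiggsCovariance HiggsCovariancePos
open HiggsCovarianceCont (sNorm sNorm_nonneg sNorm_sq abs_siteInner_le)
open HiggsFluctMeasurePos (siteInner_comm siteInner_add_right siteInner_smul_right siteInner_sub_right)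
open B2Ineq329ZeroAveraging (mesh_eq)
open B1Ineq233Upper (sum_bond_src_sq)
open B1Ineq234LevelZero (tdist_shift_le_one tdist_comm)
open B1Cor23ZeroFieldRegion (tdist_le_of_blockIter_eq_real exists_weight)
open B1Cor23DerivZeroFieldRegion (bondInner_comm)
open B1Prop23ZeroFieldRegion (siteInner_indicator_self_le)
open B1Cor23RegularRegion (covDeriv_eq covOpK_conj_ge sNorm_conj_propagatorK_le propagatorK_indicator_comm propagatorK_supported
  delta_admissible)
open B1Ineq18RegularRegion (coercive_covOpK_regular_region_uniform gammaReg_pos)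
open B1Eq230FluctCovPos (siteInner_propagatorK_comm)

variable {P : HiggsLattice.Params} {N : ℕ} {k : ℕ}

/-! ## §0 Elementary -/

section Elementary

/-- `|e^x − 1| ≤ 2|x|` for `|x| ≤ 1`. [folklore] -/
private theorem abs_exp_sub_one_le_two_mul {x : ℝ} (h : |x| ≤ 1) : |Real.exp x - 1| ≤ 2 * |x| := by
  have h1 := Real.abs_exp_sub_one_sub_id_le h
  have hx2 : x ^ 2 ≤ |x| := by
    have : |x| ^ 2 ≤ |x| * 1 := by nlinarith [abs_nonneg x]
    rw [sq_abs] at this; linarith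
  calc |Real.exp x - 1| = |(Real.exp x - 1 - x) + x| := by ring_nf
    _ ≤ |Real.exp x - 1 - x| + |x| := abs_add_le _ _
    _ ≤ 2 * |x| := by linarith

/-- Cauchy–Schwarz for a finite sum with a constant nonnegative weight. [folklore] -/
private theorem sum_weight_mul_le {ι : Type*} (s : Finset ι) {c : ℝ} (hc : 0 ≤ c) (a b : ι → ℝ) :
    ∑ i ∈ s, c * (a i * b i) ≤ Real.sqrt (∑ i ∈ s, c * a i ^ 2) * Real.sqrt (∑ i ∈ s, c * b i ^ 2) := by
  have hcs := Finset.sum_mul_sq_le_sq_mul_sq s a b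
  have h1 : |∑ i ∈ s, a i * b i| ≤ Real.sqrt ((∑ i ∈ s, a i ^ 2) * ∑ i ∈ s, b i ^ 2) := Real.abs_le_sqrt hcs
  rw [Real.sqrt_mul (Finset.sum_nonneg fun i _ => sq_nonneg (a i))] at h1
  have h2 : ∑ i ∈ s, a i * b i ≤ Real.sqrt (∑ i ∈ s, a i ^ 2) * Real.sqrt (∑ i ∈ s, b i ^ 2) :=
    (le_abs_self _).trans h1
  rw [← Finset.mul_sum, ← Finset.mul_sum, ← Finset.mul_sum, Real.sqrt_mul hc, Real.sqrt_mul hc]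
  have hsc : Real.sqrt c * Real.sqrt c = c := Real.mul_self_sqrt hc
  calc c * ∑ i ∈ s, a i * b i ≤ c * (Real.sqrt (∑ i ∈ s, a i ^ 2) * Real.sqrt (∑ i ∈ s, b i ^ 2)) :=
        mul_le_mul_of_nonneg_left h2 hc
    _ = (Real.sqrt c * Real.sqrt c) * (Real.sqrt (∑ i ∈ s, a i ^ 2) * Real.sqrt (∑ i ∈ s, b i ^ 2)) := by rw [hsc]
    _ = Real.sqrt c * Real.sqrt (∑ i ∈ s, a i ^ 2) * (Real.sqrt c * Real.sqrt (∑ i ∈ s, b i ^ 2)) := by ring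

end Elementary

/-! ## §1 The weighted covariant Leibniz rule -/

section Leibniz

variable (C : ChargeData N)

/-- **Weighted covariant Leibniz rule**: `D_A(e^{−ρ}w)(b) = e^{−ρ(b₊)}D_Aw(b) + ε^{−1}(e^{−ρ(b₊)} − e^{−ρ(b₋)})w(b₋)` (`U(A_b)` linear).
[cite: Balaban1982Higgs1, (1.7) p.605] -/
theorem covDeriv_expNegSmul (A : HiggsLattice.VecField P 0) (ρ : HiggsLattice.Site P 0 → ℝ) (w : ScalarField P 0 N)
    (b : HiggsLattice.PBond P 0) :
    covDeriv C A (fun x => Real.exp (-ρ x) • w x) b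
      = Real.exp (-ρ b.tgt) • covDeriv C A w b
        + ((P.mesh 0)⁻¹ * (Real.exp (-ρ b.tgt) - Real.exp (-ρ b.src))) • w b.src := by
  rw [covDeriv_eq, covDeriv_eq, ContinuousLinearMap.map_smul]
  module

/-- **`|D_A(e^{−ρ}w)(b)| ≤ e^{−ρ(b₊)}(|D_Aw(b)| + 2σε^{−1}|w(b₋)|)`** for `|ρ(b₊) − ρ(b₋)| ≤ σ ≤ 1`.
[cite: Balaban1983RegularityDecay, Cor. 2.3 (2.30) p.580] -/
theorem norm_covDeriv_expNegSmul_le (A : HiggsLattice.VecField P 0) (ρ : HiggsLattice.Site P 0 → ℝ) {σ : ℝ} (hσ : σ ≤ 1)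
    (w : ScalarField P 0 N) (b : HiggsLattice.PBond P 0) (hρ : |ρ b.tgt - ρ b.src| ≤ σ) :
    ‖covDeriv C A (fun x => Real.exp (-ρ x) • w x) b‖
      ≤ Real.exp (-ρ b.tgt) * (‖covDeriv C A w b‖ + 2 * σ * (P.mesh 0)⁻¹ * ‖w b.src‖) := by
  have hm : 0 < P.mesh 0 := P.mesh_pos 0
  rw [covDeriv_expNegSmul]
  have hfac : Real.exp (-ρ b.tgt) - Real.exp (-ρ b.src) = Real.exp (-ρ b.tgt) * (1 - Real.exp (ρ b.tgt - ρ b.src)) := by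
    rw [mul_sub, mul_one, ← Real.exp_add]; ring_nf
  have h1 : |1 - Real.exp (ρ b.tgt - ρ b.src)| ≤ 2 * σ := by
    rw [abs_sub_comm]
    exact (abs_exp_sub_one_le_two_mul (hρ.trans hσ)).trans (by linarith)
  calc ‖Real.exp (-ρ b.tgt) • covDeriv C A w b + ((P.mesh 0)⁻¹ * (Real.exp (-ρ b.tgt) - Real.exp (-ρ b.src))) • w b.src‖
      ≤ ‖Real.exp (-ρ b.tgt) • covDeriv C A w b‖ + ‖((P.mesh 0)⁻¹ * (Real.exp (-ρ b.tgt) - Real.exp (-ρ b.src))) • w b.src‖ :=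
        norm_add_le _ _
    _ = Real.exp (-ρ b.tgt) * ‖covDeriv C A w b‖
        + (P.mesh 0)⁻¹ * (Real.exp (-ρ b.tgt) * |1 - Real.exp (ρ b.tgt - ρ b.src)|) * ‖w b.src‖ := by
        rw [norm_smul, norm_smul, Real.norm_eq_abs, Real.norm_eq_abs, abs_of_pos (Real.exp_pos _), hfac, abs_mul,
          abs_mul, abs_of_pos (inv_pos.mpr hm), abs_of_pos (Real.exp_pos _)]
    _ ≤ Real.exp (-ρ b.tgt) * ‖covDeriv C A w b‖ + (P.mesh 0)⁻¹ * (Real.exp (-ρ b.tgt) * (2 * σ)) * ‖w b.src‖ := by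
        have := mul_le_mul_of_nonneg_left h1 (Real.exp_pos (-ρ b.tgt)).le
        have h2 : 0 ≤ (P.mesh 0)⁻¹ := (inv_pos.mpr hm).le
        nlinarith [norm_nonneg (w b.src), mul_nonneg h2 (norm_nonneg (w b.src))]
    _ = Real.exp (-ρ b.tgt) * (‖covDeriv C A w b‖ + 2 * σ * (P.mesh 0)⁻¹ * ‖w b.src‖) := by ring

end Leibniz

/-! ## §2 The Dirichlet-form bound for the conjugated solution at a general `A` -/

section Energy

variable (C : ChargeData N) (A : HiggsLattice.VecField P 0) {msq a : ℝ}

/-- **`⟨w, −Δ_{A,Ω}w⟩ ≤ (4/γ)(L^kε)²‖g′‖²`** for `w = e^{ρ}G^ε_k(Ω,A)g′` under the hypotheses of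
`B1Cor23RegularRegion.sNorm_conj_propagatorK_le` (coercivity `γ` on the `Ω`-supported fields, admissible `δ`, exponent `ρ` vanishing on
`supp g′`). [cite: Balaban1983RegularityDecay, Cor. 2.3 (2.30) p.580] -/
theorem dirichlet_conj_propagatorK_le (hk : k ≤ P.K) (Ω : Finset (HiggsLattice.Site P 0))
    (hΩ : ∀ x x' : HiggsLattice.Site P 0, blockIter k x = blockIter k x' → (x ∈ Ω ↔ x' ∈ Ω))
    (hmsq : 0 < msq) (hak : 0 ≤ B1.aSeq a P.L k) {γ : ℝ} (hγ : 0 < γ)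
    (hlow : ∀ w : ScalarField P 0 N, (∀ x, x ∉ Ω → w x = 0) →
      γ * ((P.mesh k)⁻¹ ^ 2) * siteInner w w ≤ siteInner w (covOpK C Ω A msq a k w))
    {δ : ℝ} (hδ0 : 0 ≤ δ) (hδ1 : δ ≤ 1) (hδ : 2 * (2 * P.d * δ ^ 2 + B1.aSeq a P.L k * (2 * δ)) ≤ γ)
    (ρ : HiggsLattice.Site P 0 → ℝ) (hρbond : ∀ b : HiggsLattice.PBond P 0, |ρ b.tgt - ρ b.src| ≤ δ / (P.L : ℝ) ^ k)
    (hρblock : ∀ x x' : HiggsLattice.Site P 0, blockIter k x = blockIter k x' → |ρ x - ρ x'| ≤ δ)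
    (g' : ScalarField P 0 N) (hg' : ∀ x, x ∉ Ω → g' x = 0) (hρg' : ∀ x, g' x ≠ 0 → ρ x = 0) :
    siteInner (fun x => Real.exp (ρ x) • propagatorK C Ω A msq a k g' x)
        (covLaplacianN C Ω A (fun x => Real.exp (ρ x) • propagatorK C Ω A msq a k g' x))
      ≤ 4 / γ * P.mesh k ^ 2 * siteInner g' g' := by
  have hM : 0 < P.mesh k := P.mesh_pos k
  have hLk : (1 : ℝ) ≤ (P.L : ℝ) ^ k := by exact_mod_cast Nat.one_le_pow _ _ P.hL
  have hLpos : (0 : ℝ) < (P.L : ℝ) ^ k := by linarith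
  have hσ1 : δ / (P.L : ℝ) ^ k ≤ 1 := by
    rw [div_le_one hLpos]
    exact hδ1.trans hLk
  have hwn := sNorm_conj_propagatorK_le C A hk Ω hΩ hmsq hak hγ hlow hδ0 hδ1 hδ ρ hρbond hρblock g' hg' hρg'
  obtain ⟨u, hu⟩ : ∃ u : ScalarField P 0 N, u = propagatorK C Ω A msq a k g' := ⟨_, rfl⟩
  obtain ⟨w, hw⟩ : ∃ w : ScalarField P 0 N, w = fun x => Real.exp (ρ x) • u x := ⟨_, rfl⟩
  have hgoal : (fun x => Real.exp (ρ x) • propagatorK C Ω A msq a k g' x) = w := by rw [hw, hu]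
  rw [hgoal] at hwn ⊢
  have hu_eq : (fun x => Real.exp (-ρ x) • w x) = u := by
    funext x
    rw [hw]
    simp only [smul_smul, ← Real.exp_add, neg_add_cancel, Real.exp_zero, one_smul]
  have hS_eq : siteInner (fun x => Real.exp (ρ x) • w x) (covOpK C Ω A msq a k (fun x => Real.exp (-ρ x) • w x))
      = siteInner w g' := by
    rw [hu_eq, hu, covOpK_propagatorK_apply C Ω _ hmsq a k hak]
    unfold siteInner
    refine Finset.sum_congr rfl fun x _ => ?_
    by_cases hx : g' x = 0
    · simp [hx]
    · simp only [hρg' x hx, Real.exp_zero, one_smul]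
  have hS_ge := covOpK_conj_ge C hk Ω A msq hak ρ hσ1 hρbond hρblock w
  rw [hS_eq] at hS_ge
  have hCS : siteInner w g' ≤ sNorm w * sNorm g' := (le_abs_self _).trans (abs_siteInner_le w g')
  have hH : siteInner w (covOpK C Ω A msq a k w)
      = siteInner w (covLaplacianN C Ω A w) + msq * siteInner w w
        + B1.aSeq a P.L k * ((P.mesh k)⁻¹ ^ 2) * siteInner w (projPk C A k w) := by
    rw [covOpK, LinearMap.add_apply, LinearMap.add_apply, LinearMap.smul_apply, LinearMap.smul_apply,
      LinearMap.id_apply, siteInner_add_right, siteInner_add_right, siteInner_smul_right, siteInner_smul_right]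
  have hP := siteInner_projPk_nonneg C A k w
  have hww : 0 ≤ siteInner w w := siteInner_self_nonneg w
  have hmesh : P.mesh k = (P.L : ℝ) ^ k * P.mesh 0 := mesh_eq k
  have hm0 : 0 < P.mesh 0 := P.mesh_pos 0
  have herr1 : 2 * P.d * (δ / (P.L : ℝ) ^ k) ^ 2 * (P.mesh 0)⁻¹ ^ 2 = 2 * P.d * δ ^ 2 * (P.mesh k)⁻¹ ^ 2 := by
    rw [hmesh]
    field_simp
  have herr2 : Real.exp δ - 1 ≤ 2 * δ := by
    have h := Real.abs_exp_sub_one_sub_id_le (show |δ| ≤ 1 by rwa [abs_of_nonneg hδ0])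
    have e := (abs_le.mp h).2
    nlinarith
  have hMi : 0 < (P.mesh k)⁻¹ ^ 2 := by positivity
  have herr : (2 * P.d * (δ / (P.L : ℝ) ^ k) ^ 2 * (P.mesh 0)⁻¹ ^ 2
      + B1.aSeq a P.L k * ((P.mesh k)⁻¹ ^ 2) * (Real.exp δ - 1)) * siteInner w w
        ≤ γ / 2 * (P.mesh k)⁻¹ ^ 2 * siteInner w w := by
    rw [herr1]
    refine mul_le_mul_of_nonneg_right ?_ hww
    have h1 : B1.aSeq a P.L k * ((P.mesh k)⁻¹ ^ 2) * (Real.exp δ - 1)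
        ≤ B1.aSeq a P.L k * ((P.mesh k)⁻¹ ^ 2) * (2 * δ) :=
      mul_le_mul_of_nonneg_left herr2 (mul_nonneg hak hMi.le)
    have h2 := mul_le_mul_of_nonneg_right hδ hMi.le
    linarith only [h1, h2]
  have hA := sNorm_nonneg w
  have hB := sNorm_nonneg g'
  have hAB : sNorm w * sNorm g' ≤ 2 / γ * P.mesh k ^ 2 * sNorm g' * sNorm g' := by
    have := mul_le_mul_of_nonneg_right hwn hB
    linarith
  have hA2 : γ / 2 * (P.mesh k)⁻¹ ^ 2 * siteInner w w ≤ 2 / γ * P.mesh k ^ 2 * sNorm g' * sNorm g' := by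
    rw [← sNorm_sq]
    have h1 : sNorm w ^ 2 ≤ (2 / γ * P.mesh k ^ 2 * sNorm g') ^ 2 := pow_le_pow_left₀ hA hwn 2
    have h2 : γ / 2 * (P.mesh k)⁻¹ ^ 2 * (2 / γ * P.mesh k ^ 2 * sNorm g') ^ 2
        = 2 / γ * P.mesh k ^ 2 * sNorm g' * sNorm g' := by
      field_simp
    calc γ / 2 * (P.mesh k)⁻¹ ^ 2 * sNorm w ^ 2 ≤ γ / 2 * (P.mesh k)⁻¹ ^ 2 * (2 / γ * P.mesh k ^ 2 * sNorm g') ^ 2 :=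
          mul_le_mul_of_nonneg_left h1 (by positivity)
      _ = _ := h2
  have hgg : sNorm g' * sNorm g' = siteInner g' g' := by rw [← sq, sNorm_sq]
  rw [hH] at hS_ge
  have hcP : 0 ≤ B1.aSeq a P.L k * ((P.mesh k)⁻¹ ^ 2) * siteInner w (projPk C A k w) :=
    mul_nonneg (mul_nonneg hak hMi.le) hP
  have hmw : 0 ≤ msq * siteInner w w := mul_nonneg hmsq.le hww
  have hD : siteInner w (covLaplacianN C Ω A w)
      ≤ siteInner w g' + (2 * P.d * (δ / (P.L : ℝ) ^ k) ^ 2 * (P.mesh 0)⁻¹ ^ 2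
          + B1.aSeq a P.L k * ((P.mesh k)⁻¹ ^ 2) * (Real.exp δ - 1)) * siteInner w w := by
    linarith [hS_ge, hcP, hmw]
  have h1 : siteInner w g' ≤ 2 / γ * P.mesh k ^ 2 * sNorm g' * sNorm g' := hCS.trans hAB
  have h2 := herr.trans hA2
  have hfin : 4 / γ * P.mesh k ^ 2 * siteInner g' g'
      = 2 / γ * P.mesh k ^ 2 * sNorm g' * sNorm g' + 2 / γ * P.mesh k ^ 2 * sNorm g' * sNorm g' := by
    rw [← hgg]; ring
  rw [hfin]
  linarith [hD, h1, h2]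

end Energy

/-! ## §3 The second pairing `⟨h, D^ε_AG^ε_k(Ω,A)g′⟩` (bond fields `h` on the bonds inside `Ω`, sources `g′ ⊂ Ω`) -/

section PairingDG

variable (C : ChargeData N) (A : HiggsLattice.VecField P 0) {msq a : ℝ}

/-- The covariant Neumann Dirichlet form as a bond sum of squares: `⟨w, −Δ_{A,Ω}w⟩ = Σ_b ε^d·X_b²`, `X_b = |D_Aw(b)|·1[b ⊂ Ω]`.
[cite: Balaban1982Higgs1, (2.17) p.610] -/
theorem dirichlet_eq_sum_sq (Ω : Finset (HiggsLattice.Site P 0)) (w : ScalarField P 0 N) :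
    siteInner w (covLaplacianN C Ω A w)
      = ∑ b : HiggsLattice.PBond P 0, P.mesh 0 ^ P.d * (if Inside Ω b then ‖covDeriv C A w b‖ else 0) ^ 2 := by
  rw [siteInner_covLaplacianN]
  refine Finset.sum_congr rfl fun b _ => ?_
  split_ifs
  · rw [real_inner_self_eq_norm_sq]
  · simp

/-- **The bond-pairing estimate behind the derivative pairings at a general `A`**: for `u = e^{−ρ}w` with `|∂ρ| ≤ σ ≤ 1` per bond, a
bond field `h` vanishing off the bonds inside `Ω`, and `e^{−ρ(b₊)} ≤ E` on the bonds where `h ≠ 0`: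
`|⟨h, D^ε_Au⟩| ≤ E·(‖h‖·⟨w,−Δ_{A,Ω}w⟩^{1/2} + 2σε^{−1}·‖h‖·(d‖w‖²)^{1/2})`. [cite: Balaban1983RegularityDecay, Cor. 2.3 (2.30) p.580] -/
theorem abs_bondInner_covDeriv_le (Ω : Finset (HiggsLattice.Site P 0)) (ρ : HiggsLattice.Site P 0 → ℝ) {σ : ℝ}
    (hσ1 : σ ≤ 1) (hρbond : ∀ b : HiggsLattice.PBond P 0, |ρ b.tgt - ρ b.src| ≤ σ)
    (u w : ScalarField P 0 N) (hu_eq : u = fun x => Real.exp (-ρ x) • w x)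
    (h : HiggsLattice.PBond P 0 → E N) (hh : ∀ b, ¬ Inside Ω b → h b = 0) {E : ℝ} (hE0 : 0 ≤ E)
    (hexp_b : ∀ b : HiggsLattice.PBond P 0, h b ≠ 0 → Real.exp (-ρ b.tgt) ≤ E) :
    |bondInner h (covDeriv C A u)|
      ≤ E * (Real.sqrt (bondInner h h) * Real.sqrt (siteInner w (covLaplacianN C Ω A w))
          + 2 * σ * (P.mesh 0)⁻¹ * (Real.sqrt (bondInner h h) * Real.sqrt (P.d * siteInner w w))) := by
  have hm0 : 0 < P.mesh 0 := P.mesh_pos 0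
  have hmd : 0 < P.mesh 0 ^ P.d := pow_pos hm0 _
  have hσ0 : 0 ≤ σ := by
    obtain ⟨b⟩ : Nonempty (HiggsLattice.PBond P 0) := ⟨⟨fun _ => 0, ⟨0, P.hd⟩⟩⟩
    exact (abs_nonneg _).trans (hρbond b)
  set X : HiggsLattice.PBond P 0 → ℝ := fun b => if Inside Ω b then ‖covDeriv C A w b‖ else 0 with hX
  have hterm : ∀ b : HiggsLattice.PBond P 0,
      |P.mesh 0 ^ P.d * ⟪h b, covDeriv C A u b⟫_ℝ|
        ≤ E * (P.mesh 0 ^ P.d * (‖h b‖ * X b) + 2 * σ * (P.mesh 0)⁻¹ * (P.mesh 0 ^ P.d * (‖h b‖ * ‖w b.src‖))) := by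
    intro b
    by_cases hb : h b = 0
    · rw [hb]
      simp
    · have hin : Inside Ω b := by
        by_contra hni
        exact hb (hh b hni)
      have hXb : X b = ‖covDeriv C A w b‖ := by rw [hX]; simp only; rw [if_pos hin]
      have hcd : ‖covDeriv C A u b‖ ≤ Real.exp (-ρ b.tgt) * (‖covDeriv C A w b‖ + 2 * σ * (P.mesh 0)⁻¹ * ‖w b.src‖) := by
        rw [hu_eq]
        exact norm_covDeriv_expNegSmul_le C A ρ hσ1 w b (hρbond b)
      have hin_le : |⟪h b, covDeriv C A u b⟫_ℝ|
          ≤ ‖h b‖ * (E * (‖covDeriv C A w b‖ + 2 * σ * (P.mesh 0)⁻¹ * ‖w b.src‖)) := by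
        refine (abs_real_inner_le_norm _ _).trans (mul_le_mul_of_nonneg_left ?_ (norm_nonneg _))
        refine hcd.trans (mul_le_mul_of_nonneg_right (hexp_b b hb) ?_)
        positivity
      rw [abs_mul, abs_of_pos hmd, hXb]
      calc P.mesh 0 ^ P.d * |⟪h b, covDeriv C A u b⟫_ℝ|
          ≤ P.mesh 0 ^ P.d * (‖h b‖ * (E * (‖covDeriv C A w b‖ + 2 * σ * (P.mesh 0)⁻¹ * ‖w b.src‖))) :=
            mul_le_mul_of_nonneg_left hin_le hmd.le
        _ = _ := by ring
  have hsum : |bondInner h (covDeriv C A u)|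
      ≤ E * ((∑ b : HiggsLattice.PBond P 0, P.mesh 0 ^ P.d * (‖h b‖ * X b))
          + 2 * σ * (P.mesh 0)⁻¹ * ∑ b : HiggsLattice.PBond P 0, P.mesh 0 ^ P.d * (‖h b‖ * ‖w b.src‖)) := by
    unfold bondInner
    refine (Finset.abs_sum_le_sum_abs _ _).trans ?_
    refine (Finset.sum_le_sum fun b _ => hterm b).trans (le_of_eq ?_)
    simp only [mul_add, Finset.mul_sum, Finset.sum_add_distrib]
  have hh2 : ∑ b : HiggsLattice.PBond P 0, P.mesh 0 ^ P.d * ‖h b‖ ^ 2 = bondInner h h := by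
    unfold bondInner
    refine Finset.sum_congr rfl fun b _ => ?_
    rw [real_inner_self_eq_norm_sq]
  have hCS1 : ∑ b : HiggsLattice.PBond P 0, P.mesh 0 ^ P.d * (‖h b‖ * X b)
      ≤ Real.sqrt (bondInner h h) * Real.sqrt (siteInner w (covLaplacianN C Ω A w)) := by
    have h1 := sum_weight_mul_le (Finset.univ : Finset (HiggsLattice.PBond P 0)) hmd.le (fun b => ‖h b‖) X
    rw [hh2, ← dirichlet_eq_sum_sq C A Ω w] at h1
    exact h1
  have hCS2 : ∑ b : HiggsLattice.PBond P 0, P.mesh 0 ^ P.d * (‖h b‖ * ‖w b.src‖)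
      ≤ Real.sqrt (bondInner h h) * Real.sqrt (P.d * siteInner w w) := by
    have h1 := sum_weight_mul_le (Finset.univ : Finset (HiggsLattice.PBond P 0)) hmd.le (fun b => ‖h b‖)
      (fun b => ‖w b.src‖)
    rw [hh2, sum_bond_src_sq] at h1
    exact h1
  refine hsum.trans (mul_le_mul_of_nonneg_left (add_le_add hCS1 ?_) hE0)
  exact mul_le_mul_of_nonneg_left hCS2 (by positivity)

/-- **COR. 2.3 (2.30), SECOND PAIRING, AT A GENERAL `A` FOR REGIONS, FROM A COERCIVITY CONSTANT** (`k ≤ K`, `m² > 0`, `a_k ≥ 0`,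
coercivity `γ` of (2.20) at `A` on the `Ω`-supported fields, admissible `δ`): for every bond field `h` vanishing off the bonds inside `Ω`,
every `g′` supported in `Ω` and every `r` with `r ≤ |b₋ − x′|` whenever `h(b) ≠ 0 ≠ g′(x′)`:
`|⟨h, D^ε_AG^ε_k(Ω,A)g′⟩| ≤ (2/√γ + 4√d·δ/γ)·(L^kε)·e^{δ}e^{−δr/L^k}·‖h‖‖g′‖`. [cite: Balaban1983RegularityDecay, Cor. 2.3 (2.30) p.580] -/
theorem pairing_DG_of_coercive (hk : k ≤ P.K) (Ω : Finset (HiggsLattice.Site P 0))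
    (hΩ : ∀ x x' : HiggsLattice.Site P 0, blockIter k x = blockIter k x' → (x ∈ Ω ↔ x' ∈ Ω))
    (hmsq : 0 < msq) (hak : 0 ≤ B1.aSeq a P.L k) {γ : ℝ} (hγ : 0 < γ)
    (hlow : ∀ w : ScalarField P 0 N, (∀ x, x ∉ Ω → w x = 0) →
      γ * ((P.mesh k)⁻¹ ^ 2) * siteInner w w ≤ siteInner w (covOpK C Ω A msq a k w))
    {δ : ℝ} (hδ0 : 0 ≤ δ) (hδ1 : δ ≤ 1) (hδ : 2 * (2 * P.d * δ ^ 2 + B1.aSeq a P.L k * (2 * δ)) ≤ γ)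
    (h : HiggsLattice.PBond P 0 → E N) (hh : ∀ b, ¬ Inside Ω b → h b = 0)
    (g' : ScalarField P 0 N) (hg' : ∀ x, x ∉ Ω → g' x = 0) (r : ℝ)
    (hsep : ∀ (b : HiggsLattice.PBond P 0) (x' : HiggsLattice.Site P 0), h b ≠ 0 → g' x' ≠ 0 →
      r ≤ (HiggsLattice.Site.tdist b.src x' : ℝ)) :
    |bondInner h (covDeriv C A (propagatorK C Ω A msq a k g'))|
      ≤ (2 / Real.sqrt γ + 4 * Real.sqrt P.d * δ / γ) * P.mesh k * Real.exp δ *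
          Real.exp (-(δ * (r / (P.L : ℝ) ^ k))) * Real.sqrt (bondInner h h) * Real.sqrt (siteInner g' g') := by
  classical
  have hM : 0 < P.mesh k := P.mesh_pos k
  have hm0 : 0 < P.mesh 0 := P.mesh_pos 0
  have hmd : 0 < P.mesh 0 ^ P.d := pow_pos hm0 _
  have hLk : (1 : ℝ) ≤ (P.L : ℝ) ^ k := by exact_mod_cast Nat.one_le_pow _ _ P.hL
  have hLpos : (0 : ℝ) < (P.L : ℝ) ^ k := by linarith
  have hmesh : P.mesh k = (P.L : ℝ) ^ k * P.mesh 0 := mesh_eq k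
  have hhh : 0 ≤ bondInner h h := by
    unfold bondInner
    exact Finset.sum_nonneg fun b _ => mul_nonneg hmd.le real_inner_self_nonneg
  have hRHS : 0 ≤ (2 / Real.sqrt γ + 4 * Real.sqrt P.d * δ / γ) * P.mesh k * Real.exp δ *
      Real.exp (-(δ * (r / (P.L : ℝ) ^ k))) * Real.sqrt (bondInner h h) * Real.sqrt (siteInner g' g') := by
    positivity
  set T := Finset.univ.filter (fun x => g' x ≠ 0) with hT
  by_cases hTne : T.Nonempty
  swap
  · have hg0' : ∀ x, g' x = 0 := fun x => by
      by_contra hx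
      exact hTne ⟨x, Finset.mem_filter.mpr ⟨Finset.mem_univ _, hx⟩⟩
    have hg0 : g' = 0 := funext hg0'
    have hzero : bondInner h (covDeriv C A (propagatorK C Ω A msq a k g')) = 0 := by
      rw [hg0, map_zero]
      unfold bondInner
      refine Finset.sum_eq_zero fun b _ => ?_
      rw [covDeriv_eq]
      simp
    rw [hzero, abs_zero]
    exact hRHS
  obtain ⟨D, hDlip, hDzero, -, hDfar⟩ := exists_weight hTne
  obtain ⟨ρ, hρ⟩ : ∃ ρ : HiggsLattice.Site P 0 → ℝ, ρ = fun x => δ / (P.L : ℝ) ^ k * D x := ⟨_, rfl⟩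
  have hcoef : 0 ≤ δ / (P.L : ℝ) ^ k := div_nonneg hδ0 hLpos.le
  have hρsub : ∀ x z, ρ x - ρ z = δ / (P.L : ℝ) ^ k * (D x - D z) := fun x z => by rw [hρ]; ring
  have hρbond : ∀ b : HiggsLattice.PBond P 0, |ρ b.tgt - ρ b.src| ≤ δ / (P.L : ℝ) ^ k := by
    intro b
    have h1 : |D b.tgt - D b.src| ≤ 1 := by
      refine (hDlip b.tgt b.src).trans ?_
      rw [tdist_comm]
      exact_mod_cast tdist_shift_le_one b.src b.dir
    rw [hρsub, abs_mul, abs_of_nonneg hcoef]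
    calc δ / (P.L : ℝ) ^ k * |D b.tgt - D b.src| ≤ δ / (P.L : ℝ) ^ k * 1 := mul_le_mul_of_nonneg_left h1 hcoef
      _ = δ / (P.L : ℝ) ^ k := mul_one _
  have hρblock : ∀ x x' : HiggsLattice.Site P 0, blockIter k x = blockIter k x' → |ρ x - ρ x'| ≤ δ := by
    intro x x' hxx'
    have h1 : |D x - D x'| ≤ (P.L : ℝ) ^ k - 1 := (hDlip x x').trans (tdist_le_of_blockIter_eq_real hk hxx')
    rw [hρsub, abs_mul, abs_of_nonneg hcoef]
    calc δ / (P.L : ℝ) ^ k * |D x - D x'| ≤ δ / (P.L : ℝ) ^ k * ((P.L : ℝ) ^ k - 1) :=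
          mul_le_mul_of_nonneg_left h1 hcoef
      _ = δ - δ / (P.L : ℝ) ^ k := by field_simp
      _ ≤ δ := by linarith
  have hρg' : ∀ x, g' x ≠ 0 → ρ x = 0 := by
    intro x hx
    rw [hρ]
    simp only
    rw [hDzero x (Finset.mem_filter.mpr ⟨Finset.mem_univ _, hx⟩), mul_zero]
  have hσ1 : δ / (P.L : ℝ) ^ k ≤ 1 := by
    rw [div_le_one hLpos]
    exact hδ1.trans hLk
  have hwn := sNorm_conj_propagatorK_le C A hk Ω hΩ hmsq hak hγ hlow hδ0 hδ1 hδ ρ hρbond hρblock g' hg' hρg'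
  have hDir := dirichlet_conj_propagatorK_le C A hk Ω hΩ hmsq hak hγ hlow hδ0 hδ1 hδ ρ hρbond hρblock g' hg' hρg'
  obtain ⟨u, hu⟩ : ∃ u : ScalarField P 0 N, u = propagatorK C Ω A msq a k g' := ⟨_, rfl⟩
  obtain ⟨w, hw⟩ : ∃ w : ScalarField P 0 N, w = fun x => Real.exp (ρ x) • u x := ⟨_, rfl⟩
  have hgw : (fun x => Real.exp (ρ x) • propagatorK C Ω A msq a k g' x) = w := by rw [hw, hu]
  rw [hgw] at hwn hDir
  rw [← hu]
  have hu_eq : u = fun x => Real.exp (-ρ x) • w x := by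
    funext x
    rw [hw]
    simp only [smul_smul, ← Real.exp_add, neg_add_cancel, Real.exp_zero, one_smul]
  set Ef := Real.exp δ * Real.exp (-(δ * (r / (P.L : ℝ) ^ k))) with hEf
  have hEf0 : 0 ≤ Ef := by positivity
  have hexp_b : ∀ b : HiggsLattice.PBond P 0, h b ≠ 0 → Real.exp (-ρ b.tgt) ≤ Ef := by
    intro b hb
    have hsrc : r ≤ D b.src := hDfar b.src r fun x' hx' => hsep b x' hb (Finset.mem_filter.mp hx').2
    have htgt : D b.src - 1 ≤ D b.tgt := by
      have h1 : |D b.tgt - D b.src| ≤ 1 := by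
        refine (hDlip b.tgt b.src).trans ?_
        rw [tdist_comm]
        exact_mod_cast tdist_shift_le_one b.src b.dir
      have := (abs_le.mp h1).1
      linarith
    rw [hEf, ← Real.exp_add]
    apply Real.exp_le_exp.mpr
    have hρt : ρ b.tgt = δ / (P.L : ℝ) ^ k * D b.tgt := by rw [hρ]
    rw [hρt]
    have h1 : δ / (P.L : ℝ) ^ k * (r - 1) ≤ δ / (P.L : ℝ) ^ k * D b.tgt :=
      mul_le_mul_of_nonneg_left (by linarith) hcoef
    have h2 : δ / (P.L : ℝ) ^ k ≤ δ := by
      rw [div_le_iff₀ hLpos]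
      nlinarith
    have h3 : δ / (P.L : ℝ) ^ k * (r - 1) = δ * (r / (P.L : ℝ) ^ k) - δ / (P.L : ℝ) ^ k := by
      field_simp
    nlinarith
  have hbound := abs_bondInner_covDeriv_le C A Ω ρ hσ1 hρbond u w hu_eq h hh hEf0 hexp_b
  have hB := sNorm_nonneg g'
  have hsq1 : Real.sqrt (siteInner w (covLaplacianN C Ω A w)) ≤ 2 / Real.sqrt γ * P.mesh k * sNorm g' := by
    rw [Real.sqrt_le_left (by positivity)]
    have hγs : Real.sqrt γ ^ 2 = γ := Real.sq_sqrt hγ.le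
    have : (2 / Real.sqrt γ * P.mesh k * sNorm g') ^ 2 = 4 / γ * P.mesh k ^ 2 * siteInner g' g' := by
      rw [← sNorm_sq, mul_pow, mul_pow, div_pow, hγs]; norm_num
    rw [this]
    exact hDir
  have hsq2 : Real.sqrt (P.d * siteInner w w) ≤ Real.sqrt P.d * (2 / γ * P.mesh k ^ 2 * sNorm g') := by
    rw [Real.sqrt_mul (Nat.cast_nonneg _)]
    refine mul_le_mul_of_nonneg_left ?_ (Real.sqrt_nonneg _)
    have : Real.sqrt (siteInner w w) = sNorm w := rfl
    rw [this]
    exact hwn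
  have hhs := Real.sqrt_nonneg (bondInner h h)
  calc |bondInner h (covDeriv C A u)|
      ≤ Ef * (Real.sqrt (bondInner h h) * Real.sqrt (siteInner w (covLaplacianN C Ω A w))
          + 2 * (δ / (P.L : ℝ) ^ k) * (P.mesh 0)⁻¹ * (Real.sqrt (bondInner h h) * Real.sqrt (P.d * siteInner w w))) :=
        hbound
    _ ≤ Ef * (Real.sqrt (bondInner h h) * (2 / Real.sqrt γ * P.mesh k * sNorm g')
          + 2 * (δ / (P.L : ℝ) ^ k) * (P.mesh 0)⁻¹ *
            (Real.sqrt (bondInner h h) * (Real.sqrt P.d * (2 / γ * P.mesh k ^ 2 * sNorm g')))) := by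
        refine mul_le_mul_of_nonneg_left (add_le_add ?_ ?_) hEf0
        · exact mul_le_mul_of_nonneg_left hsq1 hhs
        · refine mul_le_mul_of_nonneg_left (mul_le_mul_of_nonneg_left hsq2 hhs) ?_
          positivity
    _ = (2 / Real.sqrt γ + 4 * Real.sqrt P.d * δ / γ) * P.mesh k * Real.exp δ *
          Real.exp (-(δ * (r / (P.L : ℝ) ^ k))) * Real.sqrt (bondInner h h) * Real.sqrt (siteInner g' g') := by
        have : Real.sqrt (siteInner g' g') = sNorm g' := rfl
        rw [this, hEf]
        have e1 : 2 * (δ / (P.L : ℝ) ^ k) * (P.mesh 0)⁻¹ *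
            (Real.sqrt (bondInner h h) * (Real.sqrt P.d * (2 / γ * P.mesh k ^ 2 * sNorm g')))
            = 4 * Real.sqrt P.d * δ / γ * P.mesh k * Real.sqrt (bondInner h h) * sNorm g' := by
          rw [hmesh]
          field_simp
          ring
        rw [e1]; ring

end PairingDG

/-! ## §4 Arbitrary sources, the adjoint `D^{ε*}_A`, and the third pairing by symmetry -/

section General

variable (C : ChargeData N) (A : HiggsLattice.VecField P 0) {msq a : ℝ}

/-- **Off-`Ω` sources do not move `D^ε_AG^ε_k(Ω,A)` on the bonds inside `Ω`** (`G1_Ω = 1_ΩG` at a general `A`,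
`B1Cor23RegularRegion.propagatorK_indicator_comm`). [cite: Balaban1982Higgs1, (2.20) p.610] -/
theorem covDeriv_propagatorK_eq_indicator (hmsq : 0 < msq) (hak : 0 ≤ B1.aSeq a P.L k) (Ω : Finset (HiggsLattice.Site P 0))
    (hΩ : ∀ x x' : HiggsLattice.Site P 0, blockIter k x = blockIter k x' → (x ∈ Ω ↔ x' ∈ Ω))
    (g' : ScalarField P 0 N) {b : HiggsLattice.PBond P 0} (hb : Inside Ω b) :
    covDeriv C A (propagatorK C Ω A msq a k g') b
      = covDeriv C A (propagatorK C Ω A msq a k (fun x => if x ∈ Ω then g' x else 0)) b := by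
  set G := propagatorK C Ω A msq a k with hG
  have hPi0 : (fun x => if x ∈ Ω then (g' - fun x => if x ∈ Ω then g' x else 0) x else 0) = 0 := by
    funext x
    simp only [Pi.sub_apply, Pi.zero_apply]
    split_ifs <;> simp
  have hcomm := propagatorK_indicator_comm C Ω A hmsq hak hΩ (g' - fun x => if x ∈ Ω then g' x else 0)
  rw [hPi0, map_zero] at hcomm
  have hx : ∀ x, x ∈ Ω → G g' x = G (fun x => if x ∈ Ω then g' x else 0) x := by
    intro x hx
    have h1 := congrFun hcomm x
    simp only [Pi.zero_apply, if_pos hx] at h1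
    rw [map_sub] at h1
    have h2 : (G g' - G fun x => if x ∈ Ω then g' x else 0) x = 0 := h1.symm
    rw [Pi.sub_apply] at h2
    exact sub_eq_zero.mp h2
  rw [covDeriv_eq, covDeriv_eq, hx b.tgt hb.2, hx b.src hb.1]

/-- **COR. 2.3 (2.30), SECOND PAIRING, AT A GENERAL `A` FOR REGIONS — ARBITRARY SOURCE `g′`** (test bond field `h` on the bonds inside
`Ω`): the bound of `pairing_DG_of_coercive` with `‖g′‖`. [cite: Balaban1983RegularityDecay, Cor. 2.3 (2.30) p.580] -/
theorem pairing_DG_of_coercive_any (hk : k ≤ P.K) (Ω : Finset (HiggsLattice.Site P 0))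
    (hΩ : ∀ x x' : HiggsLattice.Site P 0, blockIter k x = blockIter k x' → (x ∈ Ω ↔ x' ∈ Ω))
    (hmsq : 0 < msq) (hak : 0 ≤ B1.aSeq a P.L k) {γ : ℝ} (hγ : 0 < γ)
    (hlow : ∀ w : ScalarField P 0 N, (∀ x, x ∉ Ω → w x = 0) →
      γ * ((P.mesh k)⁻¹ ^ 2) * siteInner w w ≤ siteInner w (covOpK C Ω A msq a k w))
    {δ : ℝ} (hδ0 : 0 ≤ δ) (hδ1 : δ ≤ 1) (hδ : 2 * (2 * P.d * δ ^ 2 + B1.aSeq a P.L k * (2 * δ)) ≤ γ)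
    (h : HiggsLattice.PBond P 0 → E N) (hh : ∀ b, ¬ Inside Ω b → h b = 0)
    (g' : ScalarField P 0 N) (r : ℝ)
    (hsep : ∀ (b : HiggsLattice.PBond P 0) (x' : HiggsLattice.Site P 0), h b ≠ 0 → g' x' ≠ 0 →
      r ≤ (HiggsLattice.Site.tdist b.src x' : ℝ)) :
    |bondInner h (covDeriv C A (propagatorK C Ω A msq a k g'))|
      ≤ (2 / Real.sqrt γ + 4 * Real.sqrt P.d * δ / γ) * P.mesh k * Real.exp δ *
          Real.exp (-(δ * (r / (P.L : ℝ) ^ k))) * Real.sqrt (bondInner h h) * Real.sqrt (siteInner g' g') := by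
  have heq : bondInner h (covDeriv C A (propagatorK C Ω A msq a k g'))
      = bondInner h (covDeriv C A (propagatorK C Ω A msq a k (fun x => if x ∈ Ω then g' x else 0))) := by
    unfold bondInner
    refine Finset.sum_congr rfl fun b _ => ?_
    by_cases hb : Inside Ω b
    · rw [covDeriv_propagatorK_eq_indicator C A hmsq hak Ω hΩ g' hb]
    · rw [hh b hb, inner_zero_left, inner_zero_left]
  rw [heq]
  have hsupp : ∀ x, x ∉ Ω → (fun x => if x ∈ Ω then g' x else 0) x = 0 := fun x hx => by simp only [if_neg hx]
  have hsep' : ∀ (b : HiggsLattice.PBond P 0) (x' : HiggsLattice.Site P 0), h b ≠ 0 →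
      (fun x => if x ∈ Ω then g' x else 0) x' ≠ 0 → r ≤ (HiggsLattice.Site.tdist b.src x' : ℝ) := by
    intro b x' hb hx'
    refine hsep b x' hb ?_
    intro h0; apply hx'; simp [h0]
  have hmain := pairing_DG_of_coercive C A hk Ω hΩ hmsq hak hγ hlow hδ0 hδ1 hδ h hh _ hsupp r hsep'
  have hn : Real.sqrt (siteInner (fun x => if x ∈ Ω then g' x else 0) (fun x => if x ∈ Ω then g' x else 0))
      ≤ Real.sqrt (siteInner g' g') := Real.sqrt_le_sqrt (siteInner_indicator_self_le Ω g')
  have hc : 0 ≤ (2 / Real.sqrt γ + 4 * Real.sqrt P.d * δ / γ) * P.mesh k * Real.exp δ *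
      Real.exp (-(δ * (r / (P.L : ℝ) ^ k))) * Real.sqrt (bondInner h h) := by
    have := P.mesh_pos k
    have hhh : 0 ≤ Real.sqrt (bondInner h h) := Real.sqrt_nonneg _
    positivity
  exact hmain.trans (mul_le_mul_of_nonneg_left hn hc)

/-- **THE ADJOINT COVARIANT DERIVATIVE** — certification of the formula: for every `φ`,
`⟨φ, D^{ε*}_Ah⟩_{sites} = ⟨D^ε_Aφ, h⟩_{bonds}` with `(D^{ε*}_Ah)(x) = ε^{−1}Σ_ν(U(A_{⟨x−εe_ν,x⟩})*h(⟨x − εe_ν, x⟩) − h(⟨x, x + εe_ν⟩))` — the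
adjoint of (1.7) for the scalar products (1.5) (`U(A)* = U(−A)`, *"−Δ^ε_A = D^{ε*}_AD^ε_A"*, p. 605). [cite: Balaban1982Higgs1, (1.7)–(1.8) p.605, (1.5) p.604] -/
theorem siteInner_adjCovDeriv (φ : HiggsLattice.ScalarField P 0 N) (h : HiggsLattice.PBond P 0 → E N) :
    siteInner φ (fun x => (P.mesh 0)⁻¹ • ∑ ν : Fin P.d,
        (star (C.U (P.mesh 0) (A ⟨x.unshift ν, ν⟩)) (h ⟨x.unshift ν, ν⟩) - h ⟨x, ν⟩))
      = bondInner (covDeriv C A φ) h := by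
  unfold HiggsLattice.siteInner HiggsLattice.bondInner
  rw [← sum_site_dir (fun x ν => P.mesh 0 ^ P.d * ⟪covDeriv C A φ ⟨x, ν⟩, h ⟨x, ν⟩⟫_ℝ)]
  have hL : ∀ x : HiggsLattice.Site P 0,
      P.mesh 0 ^ P.d * ⟪φ x, (P.mesh 0)⁻¹ • ∑ ν : Fin P.d,
          (star (C.U (P.mesh 0) (A ⟨x.unshift ν, ν⟩)) (h ⟨x.unshift ν, ν⟩) - h ⟨x, ν⟩)⟫_ℝ
        = P.mesh 0 ^ P.d * (P.mesh 0)⁻¹ *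
            ∑ ν : Fin P.d, (⟪C.U (P.mesh 0) (A ⟨x.unshift ν, ν⟩) (φ x), h ⟨x.unshift ν, ν⟩⟫_ℝ - ⟪φ x, h ⟨x, ν⟩⟫_ℝ) := by
    intro x
    rw [real_inner_smul_right, inner_sum]
    simp_rw [inner_sub_right, inner_star_U]
    ring
  have hR : ∀ (x : HiggsLattice.Site P 0) (ν : Fin P.d),
      P.mesh 0 ^ P.d * ⟪covDeriv C A φ ⟨x, ν⟩, h ⟨x, ν⟩⟫_ℝ
        = P.mesh 0 ^ P.d * (P.mesh 0)⁻¹ *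
            (⟪C.U (P.mesh 0) (A ⟨x, ν⟩) (φ (x.shift ν)), h ⟨x, ν⟩⟫_ℝ - ⟪φ x, h ⟨x, ν⟩⟫_ℝ) := by
    intro x ν
    rw [covDeriv_eq, real_inner_smul_left, inner_sub_left]
    show P.mesh 0 ^ P.d * ((P.mesh 0)⁻¹ * (⟪C.U (P.mesh 0) (A ⟨x, ν⟩) (φ (x.shift ν)), h ⟨x, ν⟩⟫_ℝ - ⟪φ x, h ⟨x, ν⟩⟫_ℝ)) = _
    ring
  -- reindex the shifted sum: `Σ_xΣ_ν ⟪U(A_{x−e_ν,ν})φ x, h(x − e_ν)⟫ = Σ_xΣ_ν ⟪U(A_{x,ν})φ(x + e_ν), h(x)⟫`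
  have key : ∑ x : HiggsLattice.Site P 0, ∑ ν : Fin P.d,
        ⟪C.U (P.mesh 0) (A ⟨x.unshift ν, ν⟩) (φ x), h ⟨x.unshift ν, ν⟩⟫_ℝ
      = ∑ x : HiggsLattice.Site P 0, ∑ ν : Fin P.d, ⟪C.U (P.mesh 0) (A ⟨x, ν⟩) (φ (x.shift ν)), h ⟨x, ν⟩⟫_ℝ := by
    rw [Finset.sum_comm]
    conv_rhs => rw [Finset.sum_comm]
    refine Finset.sum_congr rfl fun ν _ => ?_
    exact (Fintype.sum_equiv (shiftEquiv P 0 ν) (fun y => ⟪C.U (P.mesh 0) (A ⟨y, ν⟩) (φ (y.shift ν)), h ⟨y, ν⟩⟫_ℝ)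
      (fun x => ⟪C.U (P.mesh 0) (A ⟨x.unshift ν, ν⟩) (φ x), h ⟨x.unshift ν, ν⟩⟫_ℝ) fun y => by
        show ⟪C.U (P.mesh 0) (A ⟨y, ν⟩) (φ (y.shift ν)), h ⟨y, ν⟩⟫_ℝ
          = ⟪C.U (P.mesh 0) (A ⟨(y.shift ν).unshift ν, ν⟩) (φ (y.shift ν)), h ⟨(y.shift ν).unshift ν, ν⟩⟫_ℝ
        rw [HiggsCovariancePos.unshift_shift]).symm
  calc ∑ x : HiggsLattice.Site P 0, P.mesh 0 ^ P.d * ⟪φ x, (P.mesh 0)⁻¹ • ∑ ν : Fin P.d,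
          (star (C.U (P.mesh 0) (A ⟨x.unshift ν, ν⟩)) (h ⟨x.unshift ν, ν⟩) - h ⟨x, ν⟩)⟫_ℝ
      = P.mesh 0 ^ P.d * (P.mesh 0)⁻¹ * ∑ x : HiggsLattice.Site P 0, ∑ ν : Fin P.d,
          (⟪C.U (P.mesh 0) (A ⟨x.unshift ν, ν⟩) (φ x), h ⟨x.unshift ν, ν⟩⟫_ℝ - ⟪φ x, h ⟨x, ν⟩⟫_ℝ) := by
        rw [Finset.mul_sum]
        exact Finset.sum_congr rfl fun x _ => hL x
    _ = P.mesh 0 ^ P.d * (P.mesh 0)⁻¹ * ∑ x : HiggsLattice.Site P 0, ∑ ν : Fin P.d,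
          (⟪C.U (P.mesh 0) (A ⟨x, ν⟩) (φ (x.shift ν)), h ⟨x, ν⟩⟫_ℝ - ⟪φ x, h ⟨x, ν⟩⟫_ℝ) := by
        simp only [Finset.sum_sub_distrib, key]
    _ = ∑ x : HiggsLattice.Site P 0, ∑ ν : Fin P.d, P.mesh 0 ^ P.d * ⟪covDeriv C A φ ⟨x, ν⟩, h ⟨x, ν⟩⟫_ℝ := by
        rw [Finset.mul_sum]
        refine Finset.sum_congr rfl fun x _ => ?_
        rw [Finset.mul_sum]
        exact Finset.sum_congr rfl fun ν _ => (hR x ν).symm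

/-- **COR. 2.3 (2.30), THIRD PAIRING `⟨g, G^ε_k(Ω,A)D^{ε*}_Ah⟩`, AT A GENERAL `A` FOR REGIONS, FROM A COERCIVITY CONSTANT** — by the
symmetry of `G^ε_k(Ω,A)` and the adjointness `siteInner_adjCovDeriv` it IS the second pairing with the roles of test and source exchanged.
[cite: Balaban1983RegularityDecay, Cor. 2.3 (2.30) p.580] -/
theorem pairing_GDt_of_coercive (hk : k ≤ P.K) (Ω : Finset (HiggsLattice.Site P 0))
    (hΩ : ∀ x x' : HiggsLattice.Site P 0, blockIter k x = blockIter k x' → (x ∈ Ω ↔ x' ∈ Ω))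
    (hmsq : 0 < msq) (hak : 0 ≤ B1.aSeq a P.L k) {γ : ℝ} (hγ : 0 < γ)
    (hlow : ∀ w : ScalarField P 0 N, (∀ x, x ∉ Ω → w x = 0) →
      γ * ((P.mesh k)⁻¹ ^ 2) * siteInner w w ≤ siteInner w (covOpK C Ω A msq a k w))
    {δ : ℝ} (hδ0 : 0 ≤ δ) (hδ1 : δ ≤ 1) (hδ : 2 * (2 * P.d * δ ^ 2 + B1.aSeq a P.L k * (2 * δ)) ≤ γ)
    (g : ScalarField P 0 N) (h : HiggsLattice.PBond P 0 → E N) (hh : ∀ b, ¬ Inside Ω b → h b = 0) (r : ℝ)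
    (hsep : ∀ (b : HiggsLattice.PBond P 0) (x : HiggsLattice.Site P 0), h b ≠ 0 → g x ≠ 0 →
      r ≤ (HiggsLattice.Site.tdist b.src x : ℝ)) :
    |siteInner g (propagatorK C Ω A msq a k
        (fun x => (P.mesh 0)⁻¹ • ∑ ν : Fin P.d,
          (star (C.U (P.mesh 0) (A ⟨x.unshift ν, ν⟩)) (h ⟨x.unshift ν, ν⟩) - h ⟨x, ν⟩)))|
      ≤ (2 / Real.sqrt γ + 4 * Real.sqrt P.d * δ / γ) * P.mesh k * Real.exp δ *
          Real.exp (-(δ * (r / (P.L : ℝ) ^ k))) * Real.sqrt (siteInner g g) * Real.sqrt (bondInner h h) := by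
  rw [siteInner_propagatorK_comm C Ω A msq a k, siteInner_comm, siteInner_adjCovDeriv, bondInner_comm]
  have hmain := pairing_DG_of_coercive_any C A hk Ω hΩ hmsq hak hγ hlow hδ0 hδ1 hδ h hh g r hsep
  calc _ ≤ _ := hmain
    _ = _ := by ring

end General

/-! ## §5 The region corollaries at a regular `A`: the coercivity of `B1Ineq18RegularRegion` plugged in -/

section Region

variable (C : ChargeData N) {msq a : ℝ}

/-- **[13] COR. 2.3 (2.30), SECOND PAIRING, AT A REGULAR `A` FOR REGIONS `Ω ⊂ T_ε`** (any union of `k`-fold blocks, `1 ≤ k ≤ K`,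
`m² > 0`, `a > 0`, `L > 1`, `δ ≥ 0` with `(4d + 4a)δ ≤ γ₀ = min{2, a(1 − L^{−2})/4}`, EVERY `A` whose one-step differences are `≤ δ_A`
at the sites of `Ω` with `d²·ε|e|·L^{2k}·δ_A ≤ 1/3`): for every bond field `h` vanishing off the bonds inside `Ω`, every `g′` and every
`r ≤ |b₋ − x′|` on `supp h × supp g′`: `|⟨h, D^ε_AG^ε_k(Ω,A)g′⟩| ≤ (2/√γ₀ + 4√d·δ/γ₀)·(L^kε)·e^{δ}·e^{−δr/L^k}‖h‖‖g′‖`.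
[cite: Balaban1983RegularityDecay, Cor. 2.3 (2.30) p.580] [cite: Balaban1982Higgs1, Prop. 2.1 (2.23) p.610] -/
theorem pairing_DG_regular_region (ha : 0 < a) (hL : 1 < P.L) (hmsq : 0 < msq) (hk1 : 1 ≤ k) (hk : k ≤ P.K)
    (Ω : Finset (HiggsLattice.Site P 0))
    (hΩ : ∀ x x' : HiggsLattice.Site P 0, blockIter k x = blockIter k x' → (x ∈ Ω ↔ x' ∈ Ω))
    (A : HiggsLattice.VecField P 0) {δA : ℝ}
    (hreg : ∀ z ∈ Ω, ∀ μ ν : Fin P.d, |A ⟨z.shift ν, μ⟩ - A ⟨z, μ⟩| ≤ δA)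
    (hsmall : (P.d : ℝ) ^ 2 * (P.mesh 0 * |C.e|) * ((P.L : ℝ) ^ k) ^ 2 * δA ≤ 1 / 3)
    {δ : ℝ} (hδ0 : 0 ≤ δ) (hδ : (4 * P.d + 4 * a) * δ ≤ min 2 (a * (1 - ((P.L : ℝ) ^ 2)⁻¹) / 4))
    (h : HiggsLattice.PBond P 0 → E N) (hh : ∀ b, ¬ Inside Ω b → h b = 0) (g' : ScalarField P 0 N) (r : ℝ)
    (hsep : ∀ (b : HiggsLattice.PBond P 0) (x' : HiggsLattice.Site P 0), h b ≠ 0 → g' x' ≠ 0 →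
      r ≤ (HiggsLattice.Site.tdist b.src x' : ℝ)) :
    |bondInner h (covDeriv C A (propagatorK C Ω A msq a k g'))|
      ≤ (2 / Real.sqrt (min 2 (a * (1 - ((P.L : ℝ) ^ 2)⁻¹) / 4))
            + 4 * Real.sqrt P.d * δ / min 2 (a * (1 - ((P.L : ℝ) ^ 2)⁻¹) / 4))
          * P.mesh k * Real.exp δ * Real.exp (-(δ * (r / (P.L : ℝ) ^ k))) *
          Real.sqrt (bondInner h h) * Real.sqrt (siteInner g' g') := by
  have hL' : (1 : ℝ) < (P.L : ℝ) := by exact_mod_cast hL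
  have hak : 0 ≤ B1.aSeq a P.L k := (B1.aSeq_pos ha hL' hk1).le
  have hγ := gammaReg_pos (P := P) ha hL
  obtain ⟨hδ1, hbud⟩ := delta_admissible (P := P) (k := k) ha hL hk1 hδ0 hδ
  refine pairing_DG_of_coercive_any C A hk Ω hΩ hmsq hak hγ ?_ hδ0 hδ1 hbud h hh g' r hsep
  intro w hw
  have h1 := coercive_covOpK_regular_region_uniform C (msq := msq) ha hL hk1 hk Ω hΩ A hreg hsmall w hw
  have : 0 ≤ msq * siteInner w w := mul_nonneg hmsq.le (siteInner_self_nonneg w)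
  linarith

/-- **[13] COR. 2.3 (2.30), THIRD PAIRING, AT A REGULAR `A` FOR REGIONS `Ω ⊂ T_ε`** (same data): for every `g`, every bond field `h`
vanishing off the bonds inside `Ω` and every `r ≤ |b₋ − x|` on `supp h × supp g`:
`|⟨g, G^ε_k(Ω,A)D^{ε*}_Ah⟩| ≤ (2/√γ₀ + 4√d·δ/γ₀)·(L^kε)·e^{δ}·e^{−δr/L^k}‖g‖‖h‖`.
[cite: Balaban1983RegularityDecay, Cor. 2.3 (2.30) p.580] [cite: Balaban1982Higgs1, Prop. 2.1 (2.23) p.610] -/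
theorem pairing_GDt_regular_region (ha : 0 < a) (hL : 1 < P.L) (hmsq : 0 < msq) (hk1 : 1 ≤ k) (hk : k ≤ P.K)
    (Ω : Finset (HiggsLattice.Site P 0))
    (hΩ : ∀ x x' : HiggsLattice.Site P 0, blockIter k x = blockIter k x' → (x ∈ Ω ↔ x' ∈ Ω))
    (A : HiggsLattice.VecField P 0) {δA : ℝ}
    (hreg : ∀ z ∈ Ω, ∀ μ ν : Fin P.d, |A ⟨z.shift ν, μ⟩ - A ⟨z, μ⟩| ≤ δA)
    (hsmall : (P.d : ℝ) ^ 2 * (P.mesh 0 * |C.e|) * ((P.L : ℝ) ^ k) ^ 2 * δA ≤ 1 / 3)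
    {δ : ℝ} (hδ0 : 0 ≤ δ) (hδ : (4 * P.d + 4 * a) * δ ≤ min 2 (a * (1 - ((P.L : ℝ) ^ 2)⁻¹) / 4))
    (g : ScalarField P 0 N) (h : HiggsLattice.PBond P 0 → E N) (hh : ∀ b, ¬ Inside Ω b → h b = 0) (r : ℝ)
    (hsep : ∀ (b : HiggsLattice.PBond P 0) (x : HiggsLattice.Site P 0), h b ≠ 0 → g x ≠ 0 →
      r ≤ (HiggsLattice.Site.tdist b.src x : ℝ)) :
    |siteInner g (propagatorK C Ω A msq a k
        (fun x => (P.mesh 0)⁻¹ • ∑ ν : Fin P.d,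
          (star (C.U (P.mesh 0) (A ⟨x.unshift ν, ν⟩)) (h ⟨x.unshift ν, ν⟩) - h ⟨x, ν⟩)))|
      ≤ (2 / Real.sqrt (min 2 (a * (1 - ((P.L : ℝ) ^ 2)⁻¹) / 4))
            + 4 * Real.sqrt P.d * δ / min 2 (a * (1 - ((P.L : ℝ) ^ 2)⁻¹) / 4))
          * P.mesh k * Real.exp δ * Real.exp (-(δ * (r / (P.L : ℝ) ^ k))) *
          Real.sqrt (siteInner g g) * Real.sqrt (bondInner h h) := by
  have hL' : (1 : ℝ) < (P.L : ℝ) := by exact_mod_cast hL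
  have hak : 0 ≤ B1.aSeq a P.L k := (B1.aSeq_pos ha hL' hk1).le
  have hγ := gammaReg_pos (P := P) ha hL
  obtain ⟨hδ1, hbud⟩ := delta_admissible (P := P) (k := k) ha hL hk1 hδ0 hδ
  refine pairing_GDt_of_coercive C A hk Ω hΩ hmsq hak hγ ?_ hδ0 hδ1 hbud g h hh r hsep
  intro w hw
  have h1 := coercive_covOpK_regular_region_uniform C (msq := msq) ha hL hk1 hk Ω hΩ A hreg hsmall w hw
  have : 0 ≤ msq * siteInner w w := mul_nonneg hmsq.le (siteInner_self_nonneg w)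
  linarith

end Region

/-! ## §6 The fourth pairing `⟨h, D^ε_AG^ε_k(Ω,A)D^{ε*}_Ah′⟩`: the energy estimate with a divergence-form source at a general `A` -/

section PairingDGDt

variable (C : ChargeData N) (A : HiggsLattice.VecField P 0) {msq a : ℝ}

/-- `(x − e_μ) + e_μ = x` on the torus `T_ε`. [cite: Balaban1982Higgs1, (1.4) p.604] -/
private theorem shift_unshift' (x : HiggsLattice.Site P 0) (μ : Fin P.d) : (x.unshift μ).shift μ = x := by
  funext ν
  by_cases hν : ν = μ
  · subst hν; simp [HiggsLattice.Site.shift, HiggsLattice.Site.unshift]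
  · simp [HiggsLattice.Site.shift, HiggsLattice.Site.unshift, Function.update_of_ne hν]

/-- **`supp D^{ε*}_Ah′ ⊂` the endpoints of `supp h′`**: if `(D^{ε*}_Ah′)(x) ≠ 0` then `h′(b′) ≠ 0` for a bond `b′` with `x = b′₋` or
`x = b′₊` (`U*` is linear). [cite: Balaban1982Higgs1, (1.5) p.604, (1.7) p.605] -/
theorem exists_bond_of_adjCovDeriv_ne_zero (h' : HiggsLattice.PBond P 0 → E N) {x : HiggsLattice.Site P 0}
    (hx : ((P.mesh 0)⁻¹ • ∑ ν : Fin P.d,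
      (star (C.U (P.mesh 0) (A ⟨x.unshift ν, ν⟩)) (h' ⟨x.unshift ν, ν⟩) - h' ⟨x, ν⟩)) ≠ 0) :
    ∃ b' : HiggsLattice.PBond P 0, h' b' ≠ 0 ∧ (x = b'.src ∨ x = b'.tgt) := by
  have hsum : ∑ ν : Fin P.d, (star (C.U (P.mesh 0) (A ⟨x.unshift ν, ν⟩)) (h' ⟨x.unshift ν, ν⟩) - h' ⟨x, ν⟩) ≠ 0 := by
    intro h0; exact hx (by rw [h0, smul_zero])
  obtain ⟨ν, -, hν⟩ := Finset.exists_ne_zero_of_sum_ne_zero hsum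
  by_cases h1 : h' ⟨x, ν⟩ = 0
  · refine ⟨⟨x.unshift ν, ν⟩, ?_, Or.inr ?_⟩
    · intro h2; exact hν (by rw [h1, h2, map_zero, sub_zero])
    · change x = (x.unshift ν).shift ν
      rw [shift_unshift']
  · exact ⟨⟨x, ν⟩, h1, Or.inl rfl⟩

/-- **`D^{ε*}_Ah′` is supported in `Ω`** when `h′` vanishes off the bonds inside `Ω`. [cite: Balaban1982Higgs1, (1.5) p.604] -/
theorem adjCovDeriv_supported (Ω : Finset (HiggsLattice.Site P 0)) (h' : HiggsLattice.PBond P 0 → E N)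
    (hh' : ∀ b, ¬ Inside Ω b → h' b = 0) (x : HiggsLattice.Site P 0) (hx : x ∉ Ω) :
    ((P.mesh 0)⁻¹ • ∑ ν : Fin P.d,
      (star (C.U (P.mesh 0) (A ⟨x.unshift ν, ν⟩)) (h' ⟨x.unshift ν, ν⟩) - h' ⟨x, ν⟩)) = 0 := by
  by_contra hne
  obtain ⟨b', hb', hxb'⟩ := exists_bond_of_adjCovDeriv_ne_zero C A h' hne
  have hin : Inside Ω b' := by
    by_contra hni; exact hb' (hh' b' hni)
  rcases hxb' with h | h
  · exact hx (h ▸ hin.1)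
  · exact hx (h ▸ hin.2)
set_option maxHeartbeats 400000 in
/-- **THE ENERGY ESTIMATE WITH A DIVERGENCE-FORM SOURCE AT A GENERAL `A`**: under the hypotheses of `dirichlet_conj_propagatorK_le`
with the source `D^{ε*}_Ah′` (`h′` on the bonds inside `Ω`, `ρ = 0` on `supp D^{ε*}_Ah′`), the conjugated solution
`w = e^{ρ}G^ε_k(Ω,A)D^{ε*}_Ah′` obeys `⟨w, −Δ_{A,Ω}w⟩ ≤ 16‖h′‖²` and `‖w‖² ≤ (8/γ)(L^kε)²‖h′‖²` (the gain `⟨w, D^{ε*}_Ah′⟩ = ⟨D^ε_Aw, h′⟩ ≤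
⟨w,−Δ_{A,Ω}w⟩^{1/2}‖h′‖`). [cite: Balaban1983RegularityDecay, Cor. 2.3 (2.30) p.580] -/
theorem energy_conj_propagatorK_adjCovDeriv_le (hk : k ≤ P.K) (Ω : Finset (HiggsLattice.Site P 0))
    (hΩ : ∀ x x' : HiggsLattice.Site P 0, blockIter k x = blockIter k x' → (x ∈ Ω ↔ x' ∈ Ω))
    (hmsq : 0 < msq) (hak : 0 ≤ B1.aSeq a P.L k) {γ : ℝ} (hγ : 0 < γ)
    (hlow : ∀ w : ScalarField P 0 N, (∀ x, x ∉ Ω → w x = 0) →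
      γ * ((P.mesh k)⁻¹ ^ 2) * siteInner w w ≤ siteInner w (covOpK C Ω A msq a k w))
    {δ : ℝ} (hδ0 : 0 ≤ δ) (hδ1 : δ ≤ 1) (hδ : 2 * (2 * P.d * δ ^ 2 + B1.aSeq a P.L k * (2 * δ)) ≤ γ)
    (ρ : HiggsLattice.Site P 0 → ℝ) (hρbond : ∀ b : HiggsLattice.PBond P 0, |ρ b.tgt - ρ b.src| ≤ δ / (P.L : ℝ) ^ k)
    (hρblock : ∀ x x' : HiggsLattice.Site P 0, blockIter k x = blockIter k x' → |ρ x - ρ x'| ≤ δ)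
    (h' : HiggsLattice.PBond P 0 → E N) (hh' : ∀ b, ¬ Inside Ω b → h' b = 0)
    (f' : ScalarField P 0 N) (hf' : f' = fun x => (P.mesh 0)⁻¹ • ∑ ν : Fin P.d,
      (star (C.U (P.mesh 0) (A ⟨x.unshift ν, ν⟩)) (h' ⟨x.unshift ν, ν⟩) - h' ⟨x, ν⟩))
    (hρf' : ∀ x, f' x ≠ 0 → ρ x = 0) :
    siteInner (fun x => Real.exp (ρ x) • propagatorK C Ω A msq a k f' x)
        (covLaplacianN C Ω A (fun x => Real.exp (ρ x) • propagatorK C Ω A msq a k f' x))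
        ≤ 16 * bondInner h' h'
      ∧ siteInner (fun x => Real.exp (ρ x) • propagatorK C Ω A msq a k f' x)
          (fun x => Real.exp (ρ x) • propagatorK C Ω A msq a k f' x)
        ≤ 8 / γ * P.mesh k ^ 2 * bondInner h' h' := by
  have hM : 0 < P.mesh k := P.mesh_pos k
  have hm0 : 0 < P.mesh 0 := P.mesh_pos 0
  have hmd : 0 < P.mesh 0 ^ P.d := pow_pos hm0 _
  have hLk : (1 : ℝ) ≤ (P.L : ℝ) ^ k := by exact_mod_cast Nat.one_le_pow _ _ P.hL
  have hLpos : (0 : ℝ) < (P.L : ℝ) ^ k := by linarith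
  have hσ1 : δ / (P.L : ℝ) ^ k ≤ 1 := by
    rw [div_le_one hLpos]
    exact hδ1.trans hLk
  have hf'supp : ∀ x, x ∉ Ω → f' x = 0 := fun x hx => by rw [hf']; exact adjCovDeriv_supported C A Ω h' hh' x hx
  obtain ⟨u, hu⟩ : ∃ u : ScalarField P 0 N, u = propagatorK C Ω A msq a k f' := ⟨_, rfl⟩
  obtain ⟨w, hw⟩ : ∃ w : ScalarField P 0 N, w = fun x => Real.exp (ρ x) • u x := ⟨_, rfl⟩
  have hgoal : (fun x => Real.exp (ρ x) • propagatorK C Ω A msq a k f' x) = w := by rw [hw, hu]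
  rw [hgoal]
  have hu_eq : (fun x => Real.exp (-ρ x) • w x) = u := by
    funext x
    rw [hw]
    simp only [smul_smul, ← Real.exp_add, neg_add_cancel, Real.exp_zero, one_smul]
  have husupp : ∀ x, x ∉ Ω → u x = 0 := by
    rw [hu]; exact propagatorK_supported C Ω A hmsq hak hΩ f' hf'supp
  have hwsupp : ∀ x, x ∉ Ω → w x = 0 := fun x hx => by rw [hw]; simp only [husupp x hx, smul_zero]
  have hS_eq : siteInner (fun x => Real.exp (ρ x) • w x) (covOpK C Ω A msq a k (fun x => Real.exp (-ρ x) • w x))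
      = siteInner w f' := by
    rw [hu_eq, hu, covOpK_propagatorK_apply C Ω _ hmsq a k hak]
    unfold siteInner
    refine Finset.sum_congr rfl fun x _ => ?_
    by_cases hx : f' x = 0
    · simp [hx]
    · simp only [hρf' x hx, Real.exp_zero, one_smul]
  have hS_ge := covOpK_conj_ge C hk Ω A msq hak ρ hσ1 hρbond hρblock w
  rw [hS_eq] at hS_ge
  set Dw := siteInner w (covLaplacianN C Ω A w) with hDw
  have hDw0 : 0 ≤ Dw := by
    rw [hDw, dirichlet_eq_sum_sq]
    exact Finset.sum_nonneg fun b _ => mul_nonneg hmd.le (sq_nonneg _)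
  have hB0 : 0 ≤ bondInner h' h' := by
    unfold bondInner
    exact Finset.sum_nonneg fun b _ => mul_nonneg hmd.le real_inner_self_nonneg
  have hS_le : siteInner w f' ≤ Real.sqrt Dw * Real.sqrt (bondInner h' h') := by
    rw [hf', siteInner_adjCovDeriv]
    set X : HiggsLattice.PBond P 0 → ℝ := fun b => if Inside Ω b then ‖covDeriv C A w b‖ else 0 with hX
    have h1 : bondInner (covDeriv C A w) h' ≤ ∑ b : HiggsLattice.PBond P 0, P.mesh 0 ^ P.d * (X b * ‖h' b‖) := by
      unfold bondInner
      refine Finset.sum_le_sum fun b _ => mul_le_mul_of_nonneg_left ?_ hmd.le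
      by_cases hb : h' b = 0
      · rw [hb, inner_zero_right, norm_zero, mul_zero]
      · have hin : Inside Ω b := by
          by_contra hni; exact hb (hh' b hni)
        have hXb : X b = ‖covDeriv C A w b‖ := by rw [hX]; simp only; rw [if_pos hin]
        rw [hXb]
        exact (le_abs_self _).trans (abs_real_inner_le_norm _ _)
    have h2 := sum_weight_mul_le (Finset.univ : Finset (HiggsLattice.PBond P 0)) hmd.le X (fun b => ‖h' b‖)
    have h3 : ∑ b : HiggsLattice.PBond P 0, P.mesh 0 ^ P.d * ‖h' b‖ ^ 2 = bondInner h' h' := by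
      unfold bondInner
      refine Finset.sum_congr rfl fun b _ => ?_
      rw [real_inner_self_eq_norm_sq]
    rw [h3, ← dirichlet_eq_sum_sq C A Ω w] at h2
    exact h1.trans h2
  have hH : siteInner w (covOpK C Ω A msq a k w)
      = Dw + msq * siteInner w w + B1.aSeq a P.L k * ((P.mesh k)⁻¹ ^ 2) * siteInner w (projPk C A k w) := by
    rw [hDw, covOpK, LinearMap.add_apply, LinearMap.add_apply, LinearMap.smul_apply, LinearMap.smul_apply,
      LinearMap.id_apply, siteInner_add_right, siteInner_add_right, siteInner_smul_right, siteInner_smul_right]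
  have hP := siteInner_projPk_nonneg C A k w
  have hww : 0 ≤ siteInner w w := siteInner_self_nonneg w
  have hcoer := hlow w hwsupp
  have hmesh : P.mesh k = (P.L : ℝ) ^ k * P.mesh 0 := mesh_eq k
  have herr1 : 2 * P.d * (δ / (P.L : ℝ) ^ k) ^ 2 * (P.mesh 0)⁻¹ ^ 2 = 2 * P.d * δ ^ 2 * (P.mesh k)⁻¹ ^ 2 := by
    rw [hmesh]
    field_simp
  have herr2 : Real.exp δ - 1 ≤ 2 * δ := by
    have h := Real.abs_exp_sub_one_sub_id_le (show |δ| ≤ 1 by rwa [abs_of_nonneg hδ0])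
    have e := (abs_le.mp h).2
    nlinarith
  have hMi : 0 < (P.mesh k)⁻¹ ^ 2 := by positivity
  have herr : (2 * P.d * (δ / (P.L : ℝ) ^ k) ^ 2 * (P.mesh 0)⁻¹ ^ 2
      + B1.aSeq a P.L k * ((P.mesh k)⁻¹ ^ 2) * (Real.exp δ - 1)) * siteInner w w
        ≤ γ / 2 * (P.mesh k)⁻¹ ^ 2 * siteInner w w := by
    rw [herr1]
    refine mul_le_mul_of_nonneg_right ?_ hww
    have h1 : B1.aSeq a P.L k * ((P.mesh k)⁻¹ ^ 2) * (Real.exp δ - 1)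
        ≤ B1.aSeq a P.L k * ((P.mesh k)⁻¹ ^ 2) * (2 * δ) :=
      mul_le_mul_of_nonneg_left herr2 (mul_nonneg hak hMi.le)
    have h2 := mul_le_mul_of_nonneg_right hδ hMi.le
    linarith only [h1, h2]
  have hcP : 0 ≤ B1.aSeq a P.L k * ((P.mesh k)⁻¹ ^ 2) * siteInner w (projPk C A k w) :=
    mul_nonneg (mul_nonneg hak hMi.le) hP
  have hmw : 0 ≤ msq * siteInner w w := mul_nonneg hmsq.le hww
  rw [hH] at hS_ge hcoer
  have hquart : (1 / 4) * Dw + (1 / 4) * (γ * (P.mesh k)⁻¹ ^ 2 * siteInner w w)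
      ≤ Real.sqrt Dw * Real.sqrt (bondInner h' h') := by
    linarith [hS_ge, hS_le, herr, hcoer, hcP, hmw, hDw0]
  have hamgm : Real.sqrt Dw * Real.sqrt (bondInner h' h') ≤ Dw / 8 + 2 * bondInner h' h' := by
    have h1 : Real.sqrt Dw ^ 2 = Dw := Real.sq_sqrt hDw0
    have h2 : Real.sqrt (bondInner h' h') ^ 2 = bondInner h' h' := Real.sq_sqrt hB0
    nlinarith [sq_nonneg (Real.sqrt Dw - 4 * Real.sqrt (bondInner h' h'))]
  have hγw : 0 ≤ γ * (P.mesh k)⁻¹ ^ 2 * siteInner w w := by positivity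
  refine ⟨by linarith, ?_⟩
  have h3 : γ * (P.mesh k)⁻¹ ^ 2 * siteInner w w ≤ 8 * bondInner h' h' := by linarith
  have h4 : 8 / γ * P.mesh k ^ 2 * bondInner h' h' = (γ * (P.mesh k)⁻¹ ^ 2)⁻¹ * (8 * bondInner h' h') := by
    field_simp
  rw [h4, mul_comm (γ * (P.mesh k)⁻¹ ^ 2)⁻¹, ← div_eq_mul_inv, le_div_iff₀ (by positivity)]
  linarith

/-- **COR. 2.3 (2.30), FOURTH PAIRING, AT A GENERAL `A` FOR REGIONS, FROM A COERCIVITY CONSTANT** (`k ≤ K`, `m² > 0`, `a_k ≥ 0`,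
coercivity `γ` of (2.20) at `A` on the `Ω`-supported fields, admissible `δ`): for all bond fields `h, h′` vanishing off the bonds inside
`Ω` and every `r` with `r ≤ |b₋ − b′₋|, |b₋ − b′₊|` whenever `h(b) ≠ 0 ≠ h′(b′)`:
`|⟨h, D^ε_AG^ε_k(Ω,A)D^{ε*}_Ah′⟩| ≤ (4 + 2δ(8d/γ)^{1/2})·e^{δ}e^{−δr/L^k}·‖h‖‖h′‖` — no power of `L^kε`, as printed.
[cite: Balaban1983RegularityDecay, Cor. 2.3 (2.30) p.580] -/
theorem pairing_DGDt_of_coercive (hk : k ≤ P.K) (Ω : Finset (HiggsLattice.Site P 0))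
    (hΩ : ∀ x x' : HiggsLattice.Site P 0, blockIter k x = blockIter k x' → (x ∈ Ω ↔ x' ∈ Ω))
    (hmsq : 0 < msq) (hak : 0 ≤ B1.aSeq a P.L k) {γ : ℝ} (hγ : 0 < γ)
    (hlow : ∀ w : ScalarField P 0 N, (∀ x, x ∉ Ω → w x = 0) →
      γ * ((P.mesh k)⁻¹ ^ 2) * siteInner w w ≤ siteInner w (covOpK C Ω A msq a k w))
    {δ : ℝ} (hδ0 : 0 ≤ δ) (hδ1 : δ ≤ 1) (hδ : 2 * (2 * P.d * δ ^ 2 + B1.aSeq a P.L k * (2 * δ)) ≤ γ)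
    (h h' : HiggsLattice.PBond P 0 → E N) (hh : ∀ b, ¬ Inside Ω b → h b = 0) (hh' : ∀ b, ¬ Inside Ω b → h' b = 0)
    (r : ℝ) (hsep : ∀ b b' : HiggsLattice.PBond P 0, h b ≠ 0 → h' b' ≠ 0 →
      r ≤ (HiggsLattice.Site.tdist b.src b'.src : ℝ) ∧ r ≤ (HiggsLattice.Site.tdist b.src b'.tgt : ℝ)) :
    |bondInner h (covDeriv C A (propagatorK C Ω A msq a k
        (fun x => (P.mesh 0)⁻¹ • ∑ ν : Fin P.d,
          (star (C.U (P.mesh 0) (A ⟨x.unshift ν, ν⟩)) (h' ⟨x.unshift ν, ν⟩) - h' ⟨x, ν⟩))))|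
      ≤ (4 + 2 * δ * Real.sqrt (8 * P.d / γ)) * Real.exp δ * Real.exp (-(δ * (r / (P.L : ℝ) ^ k))) *
          Real.sqrt (bondInner h h) * Real.sqrt (bondInner h' h') := by
  classical
  have hM : 0 < P.mesh k := P.mesh_pos k
  have hm0 : 0 < P.mesh 0 := P.mesh_pos 0
  have hmd : 0 < P.mesh 0 ^ P.d := pow_pos hm0 _
  have hLk : (1 : ℝ) ≤ (P.L : ℝ) ^ k := by exact_mod_cast Nat.one_le_pow _ _ P.hL
  have hLpos : (0 : ℝ) < (P.L : ℝ) ^ k := by linarith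
  have hmesh : P.mesh k = (P.L : ℝ) ^ k * P.mesh 0 := mesh_eq k
  have hB0 : 0 ≤ bondInner h' h' := by
    unfold bondInner
    exact Finset.sum_nonneg fun b _ => mul_nonneg hmd.le real_inner_self_nonneg
  have hhh : 0 ≤ bondInner h h := by
    unfold bondInner
    exact Finset.sum_nonneg fun b _ => mul_nonneg hmd.le real_inner_self_nonneg
  set f' : ScalarField P 0 N := fun x => (P.mesh 0)⁻¹ • ∑ ν : Fin P.d,
    (star (C.U (P.mesh 0) (A ⟨x.unshift ν, ν⟩)) (h' ⟨x.unshift ν, ν⟩) - h' ⟨x, ν⟩) with hf'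
  have hRHS : 0 ≤ (4 + 2 * δ * Real.sqrt (8 * P.d / γ)) * Real.exp δ * Real.exp (-(δ * (r / (P.L : ℝ) ^ k))) *
      Real.sqrt (bondInner h h) * Real.sqrt (bondInner h' h') := by positivity
  have hsep' : ∀ (b : HiggsLattice.PBond P 0) (x : HiggsLattice.Site P 0), h b ≠ 0 → f' x ≠ 0 →
      r ≤ (HiggsLattice.Site.tdist b.src x : ℝ) := by
    intro b x hb hx
    obtain ⟨b', hb', hxb'⟩ := exists_bond_of_adjCovDeriv_ne_zero C A h' hx
    rcases hxb' with e | e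
    · rw [e]; exact (hsep b b' hb hb').1
    · rw [e]; exact (hsep b b' hb hb').2
  set T := Finset.univ.filter (fun x => f' x ≠ 0) with hT
  by_cases hTne : T.Nonempty
  swap
  · have hg0' : ∀ x, f' x = 0 := fun x => by
      by_contra hx
      exact hTne ⟨x, Finset.mem_filter.mpr ⟨Finset.mem_univ _, hx⟩⟩
    have hg0 : f' = 0 := funext hg0'
    have hzero : bondInner h (covDeriv C A (propagatorK C Ω A msq a k f')) = 0 := by
      rw [hg0, map_zero]
      unfold bondInner
      refine Finset.sum_eq_zero fun b _ => ?_
      rw [covDeriv_eq]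
      simp
    rw [hzero, abs_zero]
    exact hRHS
  obtain ⟨D, hDlip, hDzero, -, hDfar⟩ := exists_weight hTne
  obtain ⟨ρ, hρ⟩ : ∃ ρ : HiggsLattice.Site P 0 → ℝ, ρ = fun x => δ / (P.L : ℝ) ^ k * D x := ⟨_, rfl⟩
  have hcoef : 0 ≤ δ / (P.L : ℝ) ^ k := div_nonneg hδ0 hLpos.le
  have hρsub : ∀ x z, ρ x - ρ z = δ / (P.L : ℝ) ^ k * (D x - D z) := fun x z => by rw [hρ]; ring
  have hρbond : ∀ b : HiggsLattice.PBond P 0, |ρ b.tgt - ρ b.src| ≤ δ / (P.L : ℝ) ^ k := by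
    intro b
    have h1 : |D b.tgt - D b.src| ≤ 1 := by
      refine (hDlip b.tgt b.src).trans ?_
      rw [tdist_comm]
      exact_mod_cast tdist_shift_le_one b.src b.dir
    rw [hρsub, abs_mul, abs_of_nonneg hcoef]
    calc δ / (P.L : ℝ) ^ k * |D b.tgt - D b.src| ≤ δ / (P.L : ℝ) ^ k * 1 := mul_le_mul_of_nonneg_left h1 hcoef
      _ = δ / (P.L : ℝ) ^ k := mul_one _
  have hρblock : ∀ x x' : HiggsLattice.Site P 0, blockIter k x = blockIter k x' → |ρ x - ρ x'| ≤ δ := by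
    intro x x' hxx'
    have h1 : |D x - D x'| ≤ (P.L : ℝ) ^ k - 1 := (hDlip x x').trans (tdist_le_of_blockIter_eq_real hk hxx')
    rw [hρsub, abs_mul, abs_of_nonneg hcoef]
    calc δ / (P.L : ℝ) ^ k * |D x - D x'| ≤ δ / (P.L : ℝ) ^ k * ((P.L : ℝ) ^ k - 1) :=
          mul_le_mul_of_nonneg_left h1 hcoef
      _ = δ - δ / (P.L : ℝ) ^ k := by field_simp
      _ ≤ δ := by linarith
  have hρf' : ∀ x, f' x ≠ 0 → ρ x = 0 := by
    intro x hx
    rw [hρ]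
    simp only
    rw [hDzero x (Finset.mem_filter.mpr ⟨Finset.mem_univ _, hx⟩), mul_zero]
  have hσ1 : δ / (P.L : ℝ) ^ k ≤ 1 := by
    rw [div_le_one hLpos]
    exact hδ1.trans hLk
  obtain ⟨hDir, hwn⟩ := energy_conj_propagatorK_adjCovDeriv_le C A hk Ω hΩ hmsq hak hγ hlow hδ0 hδ1 hδ ρ hρbond hρblock
    h' hh' f' hf' hρf'
  obtain ⟨u, hu⟩ : ∃ u : ScalarField P 0 N, u = propagatorK C Ω A msq a k f' := ⟨_, rfl⟩
  obtain ⟨w, hw⟩ : ∃ w : ScalarField P 0 N, w = fun x => Real.exp (ρ x) • u x := ⟨_, rfl⟩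
  have hgw : (fun x => Real.exp (ρ x) • propagatorK C Ω A msq a k f' x) = w := by rw [hw, hu]
  rw [hgw] at hwn hDir
  rw [← hu]
  have hu_eq : u = fun x => Real.exp (-ρ x) • w x := by
    funext x
    rw [hw]
    simp only [smul_smul, ← Real.exp_add, neg_add_cancel, Real.exp_zero, one_smul]
  set Ef := Real.exp δ * Real.exp (-(δ * (r / (P.L : ℝ) ^ k))) with hEf
  have hEf0 : 0 ≤ Ef := by positivity
  have hexp_b : ∀ b : HiggsLattice.PBond P 0, h b ≠ 0 → Real.exp (-ρ b.tgt) ≤ Ef := by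
    intro b hb
    have hsrc : r ≤ D b.src := hDfar b.src r fun x' hx' => hsep' b x' hb (Finset.mem_filter.mp hx').2
    have htgt : D b.src - 1 ≤ D b.tgt := by
      have h1 : |D b.tgt - D b.src| ≤ 1 := by
        refine (hDlip b.tgt b.src).trans ?_
        rw [tdist_comm]
        exact_mod_cast tdist_shift_le_one b.src b.dir
      have := (abs_le.mp h1).1
      linarith
    rw [hEf, ← Real.exp_add]
    apply Real.exp_le_exp.mpr
    have hρt : ρ b.tgt = δ / (P.L : ℝ) ^ k * D b.tgt := by rw [hρ]
    rw [hρt]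
    have h1 : δ / (P.L : ℝ) ^ k * (r - 1) ≤ δ / (P.L : ℝ) ^ k * D b.tgt :=
      mul_le_mul_of_nonneg_left (by linarith) hcoef
    have h2 : δ / (P.L : ℝ) ^ k ≤ δ := by
      rw [div_le_iff₀ hLpos]
      nlinarith
    have h3 : δ / (P.L : ℝ) ^ k * (r - 1) = δ * (r / (P.L : ℝ) ^ k) - δ / (P.L : ℝ) ^ k := by
      field_simp
    nlinarith
  have hbound := abs_bondInner_covDeriv_le C A Ω ρ hσ1 hρbond u w hu_eq h hh hEf0 hexp_b
  have hB := Real.sqrt_nonneg (bondInner h' h')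
  have hsq1 : Real.sqrt (siteInner w (covLaplacianN C Ω A w)) ≤ 4 * Real.sqrt (bondInner h' h') := by
    rw [Real.sqrt_le_left (by positivity), mul_pow, Real.sq_sqrt hB0]
    norm_num
    exact hDir
  have hsq2 : Real.sqrt (P.d * siteInner w w) ≤ Real.sqrt (8 * P.d / γ) * (P.mesh k * Real.sqrt (bondInner h' h')) := by
    rw [Real.sqrt_le_left (by positivity), mul_pow, mul_pow, Real.sq_sqrt hB0, Real.sq_sqrt (by positivity)]
    have := mul_le_mul_of_nonneg_left hwn (Nat.cast_nonneg P.d)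
    calc (P.d : ℝ) * siteInner w w ≤ P.d * (8 / γ * P.mesh k ^ 2 * bondInner h' h') := this
      _ = 8 * P.d / γ * (P.mesh k ^ 2 * bondInner h' h') := by ring
  have hhs := Real.sqrt_nonneg (bondInner h h)
  calc |bondInner h (covDeriv C A u)|
      ≤ Ef * (Real.sqrt (bondInner h h) * Real.sqrt (siteInner w (covLaplacianN C Ω A w))
          + 2 * (δ / (P.L : ℝ) ^ k) * (P.mesh 0)⁻¹ * (Real.sqrt (bondInner h h) * Real.sqrt (P.d * siteInner w w))) :=
        hbound
    _ ≤ Ef * (Real.sqrt (bondInner h h) * (4 * Real.sqrt (bondInner h' h'))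
          + 2 * (δ / (P.L : ℝ) ^ k) * (P.mesh 0)⁻¹ *
            (Real.sqrt (bondInner h h) * (Real.sqrt (8 * P.d / γ) * (P.mesh k * Real.sqrt (bondInner h' h'))))) := by
        refine mul_le_mul_of_nonneg_left (add_le_add ?_ ?_) hEf0
        · exact mul_le_mul_of_nonneg_left hsq1 hhs
        · refine mul_le_mul_of_nonneg_left (mul_le_mul_of_nonneg_left hsq2 hhs) ?_
          positivity
    _ = (4 + 2 * δ * Real.sqrt (8 * P.d / γ)) * Real.exp δ * Real.exp (-(δ * (r / (P.L : ℝ) ^ k))) *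
          Real.sqrt (bondInner h h) * Real.sqrt (bondInner h' h') := by
        rw [hEf]
        have e1 : 2 * (δ / (P.L : ℝ) ^ k) * (P.mesh 0)⁻¹ *
            (Real.sqrt (bondInner h h) * (Real.sqrt (8 * P.d / γ) * (P.mesh k * Real.sqrt (bondInner h' h'))))
            = 2 * δ * Real.sqrt (8 * P.d / γ) * Real.sqrt (bondInner h h) * Real.sqrt (bondInner h' h') := by
          rw [hmesh]
          field_simp
        rw [e1]; ring

/-- **[13] COR. 2.3 (2.30), FOURTH PAIRING, AT A REGULAR `A` FOR REGIONS `Ω ⊂ T_ε`** (data as in `pairing_DG_regular_region`): for all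
bond fields `h, h′` vanishing off the bonds inside `Ω` and every `r ≤ |b₋ − b′₋|, |b₋ − b′₊|` on `supp h × supp h′`:
`|⟨h, D^ε_AG^ε_k(Ω,A)D^{ε*}_Ah′⟩| ≤ (4 + 2δ(8d/γ₀)^{1/2})·e^{δ}·e^{−δr/L^k}‖h‖‖h′‖`.
[cite: Balaban1983RegularityDecay, Cor. 2.3 (2.30) p.580] [cite: Balaban1982Higgs1, Prop. 2.1 (2.23) p.610] -/
theorem pairing_DGDt_regular_region (ha : 0 < a) (hL : 1 < P.L) (hmsq : 0 < msq) (hk1 : 1 ≤ k) (hk : k ≤ P.K)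
    (Ω : Finset (HiggsLattice.Site P 0))
    (hΩ : ∀ x x' : HiggsLattice.Site P 0, blockIter k x = blockIter k x' → (x ∈ Ω ↔ x' ∈ Ω))
    {δA : ℝ} (hreg : ∀ z ∈ Ω, ∀ μ ν : Fin P.d, |A ⟨z.shift ν, μ⟩ - A ⟨z, μ⟩| ≤ δA)
    (hsmall : (P.d : ℝ) ^ 2 * (P.mesh 0 * |C.e|) * ((P.L : ℝ) ^ k) ^ 2 * δA ≤ 1 / 3)
    {δ : ℝ} (hδ0 : 0 ≤ δ) (hδ : (4 * P.d + 4 * a) * δ ≤ min 2 (a * (1 - ((P.L : ℝ) ^ 2)⁻¹) / 4))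
    (h h' : HiggsLattice.PBond P 0 → E N) (hh : ∀ b, ¬ Inside Ω b → h b = 0) (hh' : ∀ b, ¬ Inside Ω b → h' b = 0)
    (r : ℝ) (hsep : ∀ b b' : HiggsLattice.PBond P 0, h b ≠ 0 → h' b' ≠ 0 →
      r ≤ (HiggsLattice.Site.tdist b.src b'.src : ℝ) ∧ r ≤ (HiggsLattice.Site.tdist b.src b'.tgt : ℝ)) :
    |bondInner h (covDeriv C A (propagatorK C Ω A msq a k
        (fun x => (P.mesh 0)⁻¹ • ∑ ν : Fin P.d,
          (star (C.U (P.mesh 0) (A ⟨x.unshift ν, ν⟩)) (h' ⟨x.unshift ν, ν⟩) - h' ⟨x, ν⟩))))|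
      ≤ (4 + 2 * δ * Real.sqrt (8 * P.d / min 2 (a * (1 - ((P.L : ℝ) ^ 2)⁻¹) / 4))) * Real.exp δ *
          Real.exp (-(δ * (r / (P.L : ℝ) ^ k))) * Real.sqrt (bondInner h h) * Real.sqrt (bondInner h' h') := by
  have hL' : (1 : ℝ) < (P.L : ℝ) := by exact_mod_cast hL
  have hak : 0 ≤ B1.aSeq a P.L k := (B1.aSeq_pos ha hL' hk1).le
  have hγ := gammaReg_pos (P := P) ha hL
  obtain ⟨hδ1, hbud⟩ := delta_admissible (P := P) (k := k) ha hL hk1 hδ0 hδ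
  refine pairing_DGDt_of_coercive C A hk Ω hΩ hmsq hak hγ ?_ hδ0 hδ1 hbud h h' hh hh' r hsep
  intro w hw
  have h1 := coercive_covOpK_regular_region_uniform C (msq := msq) ha hL hk1 hk Ω hΩ A hreg hsmall w hw
  have : 0 ≤ msq * siteInner w w := mul_nonneg hmsq.le (siteInner_self_nonneg w)
  linarith

end PairingDGDt

/-! ## §7 The printed quantifier shape for the three derivative pairings at a regular `A` -/

section PrintedShape

variable (C : ChargeData N) {msq a : ℝ}

/-- **The printed quantifier shape**: for `L > 1`, `a > 0` and every `d` there are `δ₀, c₀ > 0` (`δ₀ = γ₀/(4d + 4a)`,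
`c₀ = (2/√γ₀ + 4√d·δ₀/γ₀ + 4 + 2δ₀(8d/γ₀)^{1/2})e^{δ₀}`, `γ₀ = min{2, a(1 − L^{−2})/4}`) such that for EVERY torus of the model with these
`d, L`, every charge data, every `m² > 0`, every level `1 ≤ k ≤ K` with `L^kε ≤ 1`, every union `Ω` of `k`-fold blocks, EVERY vector field
`A` whose one-step differences are `≤ δ_A` at the sites of `Ω` with `d²·ε|e|·L^{2k}·δ_A ≤ 1/3` («A as in Proposition I.2.1») and every `r`:
the SECOND, THIRD and FOURTH pairings of (2.30) are `≤ c₀e^{−δ₀r/L^k}‖·‖‖·‖` for all bond fields `h, h′` vanishing off the bonds inside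
`Ω` and all site fields `g, g′` at support separation `r` (first pairing: `B1Cor23RegularRegion.cor23_first_regular_region`).
[cite: Balaban1983RegularityDecay, Cor. 2.3 (2.30) p.580] [cite: Balaban1982Higgs1, Prop. 2.1 (2.23) p.610] -/
theorem cor23_deriv_regular_region (d L : ℕ) (hL : 1 < L) {a : ℝ} (ha : 0 < a) :
    ∃ δ₀ c₀ : ℝ, 0 < δ₀ ∧ 0 < c₀ ∧
      ∀ (P : HiggsLattice.Params), P.d = d → P.L = L → ∀ (N : ℕ) (C : ChargeData N) (msq : ℝ), 0 < msq →
        ∀ (k : ℕ), 1 ≤ k → k ≤ P.K → P.mesh k ≤ 1 →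
          ∀ (Ω : Finset (HiggsLattice.Site P 0)),
            (∀ x x' : HiggsLattice.Site P 0, blockIter k x = blockIter k x' → (x ∈ Ω ↔ x' ∈ Ω)) →
              ∀ (A : HiggsLattice.VecField P 0) (δA : ℝ),
                (∀ z ∈ Ω, ∀ μ ν : Fin P.d, |A ⟨z.shift ν, μ⟩ - A ⟨z, μ⟩| ≤ δA) →
                (P.d : ℝ) ^ 2 * (P.mesh 0 * |C.e|) * ((P.L : ℝ) ^ k) ^ 2 * δA ≤ 1 / 3 → ∀ (r : ℝ),
              (∀ (h : HiggsLattice.PBond P 0 → E N) (g' : ScalarField P 0 N), (∀ b, ¬ Inside Ω b → h b = 0) →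
                (∀ (b : HiggsLattice.PBond P 0) (x' : HiggsLattice.Site P 0), h b ≠ 0 → g' x' ≠ 0 →
                  r ≤ (HiggsLattice.Site.tdist b.src x' : ℝ)) →
                |bondInner h (covDeriv C A (propagatorK C Ω A msq a k g'))|
                  ≤ c₀ * Real.exp (-(δ₀ * (r / (P.L : ℝ) ^ k))) * Real.sqrt (bondInner h h) * Real.sqrt (siteInner g' g'))
              ∧ (∀ (g : ScalarField P 0 N) (h : HiggsLattice.PBond P 0 → E N), (∀ b, ¬ Inside Ω b → h b = 0) →
                (∀ (b : HiggsLattice.PBond P 0) (x : HiggsLattice.Site P 0), h b ≠ 0 → g x ≠ 0 →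
                  r ≤ (HiggsLattice.Site.tdist b.src x : ℝ)) →
                |siteInner g (propagatorK C Ω A msq a k
                    (fun x => (P.mesh 0)⁻¹ • ∑ ν : Fin P.d,
                      (star (C.U (P.mesh 0) (A ⟨x.unshift ν, ν⟩)) (h ⟨x.unshift ν, ν⟩) - h ⟨x, ν⟩)))|
                  ≤ c₀ * Real.exp (-(δ₀ * (r / (P.L : ℝ) ^ k))) * Real.sqrt (siteInner g g) * Real.sqrt (bondInner h h))
              ∧ (∀ (h h' : HiggsLattice.PBond P 0 → E N), (∀ b, ¬ Inside Ω b → h b = 0) →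
                (∀ b, ¬ Inside Ω b → h' b = 0) →
                (∀ b b' : HiggsLattice.PBond P 0, h b ≠ 0 → h' b' ≠ 0 →
                  r ≤ (HiggsLattice.Site.tdist b.src b'.src : ℝ) ∧ r ≤ (HiggsLattice.Site.tdist b.src b'.tgt : ℝ)) →
                |bondInner h (covDeriv C A (propagatorK C Ω A msq a k
                    (fun x => (P.mesh 0)⁻¹ • ∑ ν : Fin P.d,
                      (star (C.U (P.mesh 0) (A ⟨x.unshift ν, ν⟩)) (h' ⟨x.unshift ν, ν⟩) - h' ⟨x, ν⟩))))|
                  ≤ c₀ * Real.exp (-(δ₀ * (r / (P.L : ℝ) ^ k))) * Real.sqrt (bondInner h h) *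
                    Real.sqrt (bondInner h' h')) := by
  have hL' : (1 : ℝ) < (L : ℝ) := by exact_mod_cast hL
  have hinv : ((L : ℝ) ^ 2)⁻¹ < 1 := inv_lt_one_of_one_lt₀ (by nlinarith)
  set γ₀ := min 2 (a * (1 - ((L : ℝ) ^ 2)⁻¹) / 4) with hγ₀
  have hγ : 0 < γ₀ :=
    lt_min (by norm_num) (by nlinarith [mul_pos ha (show (0:ℝ) < 1 - ((L : ℝ) ^ 2)⁻¹ by linarith)])
  have hden : (0 : ℝ) < 4 * d + 4 * a := by positivity
  set δ₀ := γ₀ / (4 * d + 4 * a) with hδ₀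
  have hδ0 : 0 < δ₀ := div_pos hγ hden
  set c₁ := 2 / Real.sqrt γ₀ + 4 * Real.sqrt d * δ₀ / γ₀ with hc₁
  set c₂ := 4 + 2 * δ₀ * Real.sqrt (8 * d / γ₀) with hc₂
  have hc₁0 : 0 ≤ c₁ := by positivity
  have hc₂0 : 0 < c₂ := by positivity
  refine ⟨δ₀, (c₁ + c₂) * Real.exp δ₀, hδ0, by positivity, ?_⟩
  intro P hPd hPL N C msq hmsq k hk1 hk hs Ω hΩ A δA hreg hsmall r
  subst hPd hPL
  have hPL1 : 1 < P.L := hL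
  have hbud : (4 * (P.d : ℝ) + 4 * a) * δ₀ ≤ min 2 (a * (1 - ((P.L : ℝ) ^ 2)⁻¹) / 4) :=
    le_of_eq (mul_div_cancel₀ _ hden.ne')
  have hM0 : 0 ≤ P.mesh k := (P.mesh_pos k).le
  have hE : 0 < Real.exp δ₀ := Real.exp_pos _
  have hK1 : c₁ * P.mesh k * Real.exp δ₀ ≤ (c₁ + c₂) * Real.exp δ₀ := by
    have h1 : c₁ * P.mesh k ≤ c₁ := by nlinarith
    nlinarith
  have hK2 : c₂ * Real.exp δ₀ ≤ (c₁ + c₂) * Real.exp δ₀ := by nlinarith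
  refine ⟨?_, ?_, ?_⟩
  · intro h g' hh hsep
    have hm := pairing_DG_regular_region C ha hPL1 hmsq hk1 hk Ω hΩ A hreg hsmall hδ0.le hbud h hh g' r hsep
    have hrest : 0 ≤ Real.exp (-(δ₀ * (r / (P.L : ℝ) ^ k))) * Real.sqrt (bondInner h h) * Real.sqrt (siteInner g' g') := by
      positivity
    calc _ ≤ _ := hm
      _ = (c₁ * P.mesh k * Real.exp δ₀) *
            (Real.exp (-(δ₀ * (r / (P.L : ℝ) ^ k))) * Real.sqrt (bondInner h h) * Real.sqrt (siteInner g' g')) := by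
          rw [hc₁]; ring
      _ ≤ ((c₁ + c₂) * Real.exp δ₀) *
            (Real.exp (-(δ₀ * (r / (P.L : ℝ) ^ k))) * Real.sqrt (bondInner h h) * Real.sqrt (siteInner g' g')) :=
          mul_le_mul_of_nonneg_right hK1 hrest
      _ = _ := by ring
  · intro g h hh hsep
    have hm := pairing_GDt_regular_region C ha hPL1 hmsq hk1 hk Ω hΩ A hreg hsmall hδ0.le hbud g h hh r hsep
    have hrest : 0 ≤ Real.exp (-(δ₀ * (r / (P.L : ℝ) ^ k))) * Real.sqrt (siteInner g g) * Real.sqrt (bondInner h h) := by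
      positivity
    calc _ ≤ _ := hm
      _ = (c₁ * P.mesh k * Real.exp δ₀) *
            (Real.exp (-(δ₀ * (r / (P.L : ℝ) ^ k))) * Real.sqrt (siteInner g g) * Real.sqrt (bondInner h h)) := by
          rw [hc₁]; ring
      _ ≤ ((c₁ + c₂) * Real.exp δ₀) *
            (Real.exp (-(δ₀ * (r / (P.L : ℝ) ^ k))) * Real.sqrt (siteInner g g) * Real.sqrt (bondInner h h)) :=
          mul_le_mul_of_nonneg_right hK1 hrest
      _ = _ := by ring
  · intro h h' hh hh' hsep
    have hm := pairing_DGDt_regular_region C A ha hPL1 hmsq hk1 hk Ω hΩ hreg hsmall hδ0.le hbud h h' hh hh' r hsep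
    have hrest : 0 ≤ Real.exp (-(δ₀ * (r / (P.L : ℝ) ^ k))) * Real.sqrt (bondInner h h) * Real.sqrt (bondInner h' h') := by
      positivity
    calc _ ≤ _ := hm
      _ = (c₂ * Real.exp δ₀) *
            (Real.exp (-(δ₀ * (r / (P.L : ℝ) ^ k))) * Real.sqrt (bondInner h h) * Real.sqrt (bondInner h' h')) := by
          rw [hc₂]; ring
      _ ≤ ((c₁ + c₂) * Real.exp δ₀) *
            (Real.exp (-(δ₀ * (r / (P.L : ℝ) ^ k))) * Real.sqrt (bondInner h h) * Real.sqrt (bondInner h' h')) :=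
          mul_le_mul_of_nonneg_right hK2 hrest
      _ = _ := by ring

end PrintedShape

end Literature.MathematicalPhysics.QuantumFieldTheory.Balaban1983to89.B1Cor23DerivRegularRegion

end
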